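import Literature.MathematicalPhysics.QuantumFieldTheory.KirchhoffFactorization
import Literature.MathematicalPhysics.QuantumFieldTheory.Volkov2016.OneTreePolynomialRayOrder
import HarnessLib

/-!
# Volkov 2016 (ЖЭТФ 149, 1164 = JETP 122, 1008) §5.3 (24): «V_{G′} V_{G/G′} ∼ V» — along the IR vector the 1-tree polynomial of `G` is asymptotically the product of those of the subgraph `G′` and of the quotient `G/G′`, PROVED for every connected edge list and every edge set; with App. C's refinement step «V_{G_b/G_a} ∼ V_{G_s/G_a} V_{G_b/G_s}» for the blocks of a nested chain, PROVED for every minor under the level-set hypothesis H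

independent recomputation; certified where stated, statistical where stated; no new-physics claim.

CITATION HEADER (venture `QEDPrecision`, cell `pub-qed`, track TROPICAL seat V3a = `pub-qed-trop-v3-lit-1` gen 31; VALUE-FREE: identities
between polynomials attached to an ARBITRARY connected edge list, an ARBITRARY line set `γ` and an ARBITRARY weight vector — no Feynman
integrand, no constant, nothing per Set V family or word). Serves `tropical/view/V3-VOLKOV-DEGREES.md` §A A.14.3 («§5.3 — THE IR
COUNTERTERM'S BLOCK STRUCTURE … THE MATCHING STATEMENT … (24)») and A.40.6's list of what is STILL PRINT-ONLY for 2015–2019 («§5.3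
(23)–(26)»). Companion of `Volkov2016/OneTreePolynomialRayOrder.lean` (the VALUE of the order of `V` on the IR vector, «V ≍ δ^{N_{G′}−1}»)
and of the LIT seat's `KirchhoffFactorization.lean` (Brown 2017 Prop. 2.2: the lowest-order part of `Ψ_G` in the `γ`-variables is
`Ψ_γ · Ψ_{G/γ}`), which this file reads along Volkov's IR vector: the printed relation «V_{G′}V_{G/G′} ∼ V» says that the δ-leading part
of `V` along `z_l ≍ δ^{β_l}` (β = 2 on `G′`, 1 on `P₁ ∪ P₂`, 0 elsewhere) coincides with the δ-leading part of Brown's product — a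
REFINEMENT statement (the IR vector is not the face normal `−𝟙_{G′}`), proved here from the exchange property of maximum-weight
spanning trees.

SOURCE [Volkov2016]: С. А. Волков, ЖЭТФ 149 (6) 1164–1191 (2016) = S. A. Volkov, J. Exp. Theor. Phys. 122 (6) 1008–1031 (2016), doi
10.1134/S1063776116050113; Russian original held by the cell (HOME `data/lit/sources/.cache/zhetf149_1164_Volkov2016/r_149_1164.pdf`,
page texts `…/journal-pdf-pages/ZhETF149-1164-Volkov2016/pNNNN.txt`, PDF page N = journal page 1163 + N; the arXiv e-print 1507.06435 is
the SHORT version without §5 / App. C). VERBATIM. §5.2 p.1175 footnote 16 (p12:L97–L99): «В рамках этой статьи f(δ) ≍ g(δ) означает,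
что 0 < C₁ < |f(δ)/g(δ)| < C₂ в некоторой окрестности предельного значения δ, f ∼ g означает lim f/g = 1.» ⟦f ≍ g: two-sided bound
near the limit value of δ; f ∼ g means lim f/g = 1⟧. §5.2 p.1175 (p12:L81–L94): «Инфракрасной расходимости соответствуют значения β_j = 2
для линий из G′, β_j = 1 для линий из P₁ и P₂, β_j = 0 для остальных линий … V ≍ δ^{N_{G′}−1} (доминирующее по степени δ дерево
состоит из P₁, P₂ и любого 1-дерева G′)». §5.3 p.1177 footnote 17 (p14:L67–L71): «Через G/G′ здесь и далее обозначается граф,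
получающийся из G заменой подграфа G′ на вершину; если G′ не является подграфом G, то полагается G/G′ = G. В данном конкретном
случае подразумевается, что линии графа G делятся на линии подграфа G′ и все остальные — линии G/G′.» ⟦G/G′ = the graph obtained
from G by replacing the subgraph G′ by a vertex; the lines of G split into those of G′ and the rest = the lines of G/G′⟧; (p14:L21–L31)
«… ∑_{K₁≥1} ∑_{K₂≥0} C_{K₁+K₂} F^{G′}_{K₁} F^{G/G′}_{K₂} / (W_{G′}/V_{G′} + W_{G/G′}/V_{G/G′})^{K₁+K₂}, при этом величины F^{G′}_{K₁},
F^{G/G′}_{K₂}, W_{G′}, W_{G/G′}, V_{G′}, V_{G/G′} строятся по правилам, аналогичным описанным выше для построения F_K, W, V» ⟦the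
blocks V_{G′}, V_{G/G′} are built by the same rules as V⟧. §5.3 p.1177 (p15:L56–L71): «Слагаемые в I′(z), соответствующие заданному
выбору пар электронных линий в G′, имеют в точности такое же асимптотическое поведение при δ → 0, как и соответствующие слагаемые в
I(z), поэтому разность I(z) − I′(z) удовлетворяет условиям утверждения 1 для рассматриваемых значений β_j. Совпадение асимптотики
вытекает из (23) и следующих асимптотических равенств (см. также [48]): V_{G′} V_{G/G′} ∼ V, B^{G′}_{j₁j₂}/V_{G′} ∼ B_{j₁j₂}/V (j₁,
j₂ ∈ G′), Q̂^{G′}_l/V_{G′} ∼ Q̂_l/V (l ∈ G′), Q̂_l/V ∼ p̂₁ (l ∈ P₁), Q̂_l/V ∼ p̂₂ (l ∈ P₂), (24) W/V ∼ W_{G′}/V_{G′} + W_{G/G′}/V_{G/G′}.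
(25)»; (p15:L88–L91): «Основная идея здесь в том, что если все величины B…, V…, Q̂… расписать в виде суммы произведений, оставить
только доминирующие по степени δ слагаемые, то мы получим точные равенства.» ⟦the terms of the counterterm integrand I′ have
EXACTLY the asymptotics of the corresponding terms of I, so I − I′ satisfies Proposition 1 at these β; this follows from (23) and the
asymptotic equalities (24)–(25), the first of which is V_{G′}V_{G/G′} ∼ V; the idea: expand V, B, Q̂ as sums of products and keep only
the δ-dominant terms — the equalities become exact⟧. (The first relation of (24) is typeset as the product V_{G′}V_{G/G′}; the degree
count ℓ(G′) + ℓ(G/G′) = ℓ(G) and the block structure 1/V² ↔ 1/(V_{G′}V_{G/G′})² of F^{G′}F^{G/G′} confirm the reading.) App. C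
p.1189 (p26:L42–L56) prints the multi-subgraph form for a nested chain G₁ ⊂ … ⊂ G_n ⊂ G: «V_{G_{i₁}/G_{i₀}} … V_{G_{i_r}/G_{i_{r−1}}}
∼ V_{G_{j₁}/G_{j₀}} … V_{G_{j_l}/G_{j_{l−1}}} ≍ δ^{(1/2)Σ_{j=0}^{n} w_j (N_{G_{j+1}} − N_{G_j})}» for two index sets containing all
transition indices and differing by inverse-transition indices only, with p.1188–1189 (p25:L96 – p26:L4) «(потому что в этом случае
электронный путь, соединяющий внешние линии, не будет доминирующим 1-деревом по степени δ)» ⟦because in that case the electron path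
joining the external lines is not the δ-dominant 1-tree⟧ — quoted for orientation; NOT typed in this file (see NOT CLAIMED).

WHAT IS TYPED (all PROVED; definitions with bodies (`IsDominantTree`, `subgraphPolynomial`, `quotientPolynomial`, `groundLines`, `baseFinsets`,
`basisPolynomial`, `blockPolynomial`, `chainProdFrom`), no named fact, no sorry; Mathlib's `Matroid` minors + the tree's cycle-matroid files only):
* §1 (any matroid, Mathlib's `Matroid`): **`isBasis_filter_of_forall_sum_le`** — a maximum-weight base `T` meets every upper level
  set `{x ∈ E : β x ≥ c}` in a basis of it; by the exchange `exists_isBase_insert_erase_of_not_isBasis` (a level-set element enters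
  along its fundamental circuit, a lighter element leaves; Oxley §1.8, Korte–Vygen Thm 13.23 (a)).
* §2 **`IsDominantTree E β T`** — Volkov's «доминирующее по степени δ дерево»: a spanning tree whose chord monomial carries the least
  power of δ along `z_l ≍ δ^{β_l}` (`isDominantTree_iff_forall_sum_le`: ⟺ maximal tree weight); `IsDominantTree.card_inter_level_eq`
  (§1 in the cycle matroid) and **`IsDominantTree.card_inter_eq_edgeRank`**: under H(γ, c) — every line outside `γ` has `β < c` and
  `rk{l ∈ γ : β_l ≥ c} = rk γ` — every dominant tree meets `γ` in a maximal spanning forest (`|T ∩ γ| = rk γ`).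
* §3 `linPair_castExp_cotree`, **`isDominantTree_iff_linPair_eq_rayOrder`** — the dominant trees are exactly the spanning trees whose
  chord monomial attains Volkov's `rayOrder` of `V` (`RayConvergenceCriterion.lean`).
* §4 `initForm_eq_of_support_subset` — a sub-sum of `p`'s monomials containing all the β-minimal ones has the same initial form.
* §5 **`subgraphPolynomial E γ`** («V_{G′}»: Σ over maximal spanning forests `F` of `γ` of `Π_{γ∖F} X`) and **`quotientPolynomial E γ`**
  («V_{G/G′}»: Σ over the bases `T′` of the contraction `M(E)/γ` of `Π_{(E∖γ)∖T′} X` — the quotient GRAPH enters through its cycle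
  matroid, Oxley's `M(G/T) = M(G)/T`, exactly as in `KirchhoffFactorization.lean`); `trunc_kirchhoffPolynomial_eq_subgraph_mul_quotient`
  (Brown's factorisation in this notation, = the LIT seat's theorem); **`initForm_kirchhoffPolynomial_eq_of_level`** — THE REFINEMENT
  THEOREM: H(γ, c) ⇒ `initForm V β = initForm (V_{G′} · V_{G/G′}) β`.
* §6 `tendsto_div_one_of_initForm_eq` (equal initial forms, non-vanishing at the base point ⇒ `f/g → 1` along `z_i = c_i δ^{β_i}`,
  footnote 16's «∼»), `tendsto_subgraph_mul_quotient_div_of_level`; the IR vector as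
  `𝟙_γ + 𝟙_{γ ∪ P}` (`irVector_apply_of_mem`, `irVector_apply_lt_two_of_not_mem`); **`initForm_kirchhoffPolynomial_irVector_eq`** and
  **`tendsto_subgraph_mul_quotient_div_irVector`** — «V_{G′} V_{G/G′} ∼ V»: for EVERY connected edge list, EVERY `γ` and EVERY `P`,
  along `z_l = c_l δ^{β_l}` (`c_l > 0`, β the IR vector) `V_{G′}(z)V_{G/G′}(z)/V(z) → 1` as `δ → 0⁺`. No hypothesis on how `P₁ ∪ P₂`
  hangs off `G′` is needed for THIS relation (H(γ, 2) holds because `{β ≥ 2} = γ`); the hypothesis `ℓ(γ ∪ P) = ℓ(γ)` of the companion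
  file is needed only for the printed VALUE `N_{G′} − 1` of the common order.
* §7 (any non-zero real polynomials) **`rayOrder_mul`**, **`initForm_mul`** — orders ADD and initial forms MULTIPLY (`ℝ[z]` has no
  zero divisors); `initForm_mul_congr_right` (refining one factor of a product); `eval_initForm_pos_of_coeff_nonneg`. These make the
  refinement theorem usable inside PRODUCTS of blocks (and give the «∼» calculus of (24)–(25) and App. C a kernel footing).
* §8 (any matroid `M` on the lines `Fin N`) `groundLines`, `baseFinsets`, **`basisPolynomial M`** («V_M» = Σ over bases `B` of
  `Π_{E(M)∖B} z`; `coeff_/support_basisPolynomial`: one monomial per base, coefficient `1`; `basisPolynomial_ne_zero`,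
  `eval_initForm_basisPolynomial_pos`) and the dictionary with §5: **`basisPolynomial_cycleMatroid`** (`V_{M(G)} = V`, `G` connected),
  **`basisPolynomial_restrict_cycleMatroid`** (`V_{M(G)|γ} = V_{G′}`), **`basisPolynomial_contract_cycleMatroid`** (`V_{M(G)/γ} = V_{G/G′}`).
* §9 `contract_isBase_iff_union_isBase` (Brown's Lemma 2.1 for any matroid: bases of `M/C` against a maximal forest of `C`) and
  **`initForm_basisPolynomial_eq_of_level`** — THE REFINEMENT THEOREM FOR A MINOR: `C ⊆ E(M)`, every line of `E(M) ∖ C` of weight `< c`,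
  `C ⊆ cl{l ∈ C : β_l ≥ c}` ⇒ `in_β V_M = in_β (V_{M|C} · V_{M/C})` (Brown's factorisation for an arbitrary matroid is re-proved on the
  way: the sub-sum over the bases meeting `C` in a basis IS `V_{M|C} V_{M/C}`); `tendsto_restrict_mul_contract_div_of_level` (the «∼»).
* §10 **`blockPolynomial M A B`** («V_{G_b/G_a}» := `V_{(M|B)/A}`; `blockPolynomial_empty`, `blockPolynomial_empty_univ` = `V`) and
  **`initForm_blockPolynomial_refine`** — ONE STEP OF APP. C's CHAINS: for line sets `A ⊆ S ⊆ B`, if the lines of `B ∖ S` have weight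
  `< c` and `S ∖ A ⊆ cl_{(M|B)/A}{l ∈ S ∖ A : β_l ≥ c}` then `in_β V_{G_b/G_a} = in_β (V_{G_s/G_a} · V_{G_b/G_s})` (minor algebra
  `((M|B)/A)|(S∖A) = (M|S)/A`, `((M|B)/A)/(S∖A) = (M|B)/S` by Mathlib); with a cofactor (`initForm_mul_blockPolynomial_refine`) and as a
  limit (`tendsto_blockPolynomial_refine_div`). Iterating this step inside the products (§7) gives the equality of the initial forms of
  two chains' products whenever the extra indices satisfy H — which is how «V_{G_{i₁}/G_{i₀}} ⋯ ∼ V_{G_{j₁}/G_{j₀}} ⋯» is read here.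
* §11 **`chainProdFrom M A [B₁,…,B_r]`** (= `V_{B₁/A} V_{B₂/B₁} ⋯ V_{B_r/B_{r−1}}`, App. C's chain product), `chainProdFrom_append_cons_cons`,
  **`initForm_chainProdFrom_insert`** — inserting a line set `S` between consecutive members `B ⊆ C` of a chain at which H holds does
  not change the initial form of the chain product (the typed form of «V_{G_{i₁}/G_{i₀}} ⋯ ∼ V_{G_{j₁}/G_{j₀}} ⋯» for chains differing
  by H-indices, one index at a time), `tendsto_chainProdFrom_insert_div` (as footnote 16's «∼»), `eval_initForm_chainProdFrom_pos`;
  **`rayOrder_basisPolynomial_eq_of_forall_sum_le`** (the order of a block = the co-weight of ANY maximum-weight base of its minor) and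
  `rayOrder_chainProdFrom_cons` (orders add along the chain) — the shape of «≍ δ^{(1/2)Σ_j w_j (N_{G_{j+1}} − N_{G_j})}».
* §12 the hypothesis H in ambient terms: `sdiff_subset_closure_block` (`X ∪ B` spans `S` in `M` ⇒ `X` spans `S ∖ B` in `(M|C)/B`),
  `subset_closure_of_edgeRank_eq` (cycle matroid: equal `edgeRank` ⇒ spanning), and the GRAPH forms
  **`initForm_blockPolynomial_refine_cycleMatroid`** / **`initForm_chainProdFrom_insert_cycleMatroid`** with the rank hypothesis
  `rk({l ∈ S ∖ B : β_l ≥ c} ∪ B) = rk S`.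
NOT CLAIMED: the other relations of (24) (`B^{G′}_{j₁j₂}/V_{G′} ∼ B_{j₁j₂}/V`, the `Q̂` relations) and (25) (`W/V`), which concern the
signed cycle-tree polynomials, the momentum numerators and the on-shell denominator; the VALUE `δ^{(1/2)Σ_j w_j (N_{G_{j+1}} − N_{G_j})}`
of App. C's products and that, on the vectors (45), H holds exactly at the inverse-transition indices of a transition-free block (the
electron path of the inner quotient carries the larger weights and spans it — «электронный путь … доминирующим 1-деревом»: a
property of QED vertex graphs, evident per graph, not modelled; the theorems take H as the hypothesis); the general induction over
two index chains (each use is a finite iteration of `initForm_chainProdFrom_insert`); that Volkov's G/G′ (a graph) has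
`M(G/G′) = M(G)/E(G′)` (Oxley's dictionary — true for a connected `G′`, which Volkov's vertexlike `G′` is; not typed); anything
about `I − I′`, Proposition 1's hypotheses for a QED graph, or any graph / word of the cell.
-/

noncomputable section

namespace Literature.MathematicalPhysics.QuantumFieldTheory.Volkov2016

open MvPolynomial Filter Finset
open scoped _root_.Topology Matroid
open Literature.MathematicalPhysics.QuantumFieldTheory
open Literature.MathematicalPhysics.QuantumFieldTheory.Borinsky2020

/-! ## §1 A maximum-weight base meets every upper level set of the weight in a basis (the exchange step of the greedy algorithm) -/

section Greedy

variable {α : Type*} [DecidableEq α] {M : Matroid α}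

/-- The exchange producing a HEAVIER base when a base fails to span an upper level set: if `T ∩ {β ≥ c}` is not a basis of
`{x ∈ E | β x ≥ c}`, some `e` of that level set enters and some `f` with `β f < c` leaves (Korte–Vygen's necessity argument
«if one of the conditions is violated for some y and x, the … set X′ := (X ∪ {y}) ∖ {x} has greater weight than X»; Oxley §1.8).
[cite: KorteVygen2018, Theorem 13.23 (a) and its proof; Oxley2011, §1.8 Lemma 1.8.3–1.8.4 (p.59)] -/
theorem exists_isBase_insert_erase_of_not_isBasis {T : Finset α} (hT : M.IsBase (T : Set α)) (β : α → ℝ) (c : ℝ)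
    (h : ¬ M.IsBasis ((T.filter fun x => c ≤ β x : Finset α) : Set α) {x | x ∈ M.E ∧ c ≤ β x}) :
    ∃ e f, e ∉ T ∧ f ∈ T ∧ c ≤ β e ∧ β f < c ∧ M.IsBase ((insert e (T.erase f) : Finset α) : Set α) := by
  set L : Set α := {x | x ∈ M.E ∧ c ≤ β x} with hL
  set I : Finset α := T.filter fun x => c ≤ β x with hI
  have hLE : L ⊆ M.E := fun x hx => hx.1
  have hIT : (I : Set α) ⊆ (T : Set α) := by
    intro x hx
    rw [hI, Finset.coe_filter] at hx
    exact hx.1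
  have hIind : M.Indep (I : Set α) := hT.indep.subset hIT
  have hIL : (I : Set α) ⊆ L := by
    intro x hx
    rw [hI, Finset.coe_filter] at hx
    exact ⟨hT.subset_ground hx.1, hx.2⟩
  obtain ⟨J, hJ⟩ := M.exists_isBasis L hLE
  obtain ⟨e, he, heI⟩ := hIind.exists_insert_of_not_isBasis hIL h hJ
  have heL : e ∈ L := hJ.subset he.1
  have heE : e ∈ M.E := heL.1
  have hce : c ≤ β e := heL.2
  have heT : e ∉ T := by
    intro heT
    refine he.2 ?_
    rw [hI, Finset.coe_filter]
    exact ⟨heT, hce⟩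
  have heT' : e ∉ (T : Set α) := fun h' => heT (Finset.mem_coe.1 h')
  -- the fundamental circuit of `e` in `T`
  have hecl : e ∈ M.closure (T : Set α) := by rw [hT.closure_eq]; exact heE
  have hK : M.IsCircuit (M.fundCircuit e (T : Set α)) := hT.indep.fundCircuit_isCircuit hecl heT'
  have hnot : ¬ (M.fundCircuit e (T : Set α) ⊆ insert e (I : Set α)) := fun hsub =>
    hK.not_indep (heI.subset hsub)
  obtain ⟨f, hfK, hfI⟩ := Set.not_subset.1 hnot
  have hfT' : f ∈ insert e (T : Set α) := M.fundCircuit_subset_insert e (T : Set α) hfK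
  have hfe : f ≠ e := fun hfe => hfI (by rw [hfe]; exact Set.mem_insert e _)
  have hfT : f ∈ T := by
    rcases Set.mem_insert_iff.1 hfT' with h' | h'
    · exact absurd h' hfe
    · exact Finset.mem_coe.1 h'
  have hfc : β f < c := by
    by_contra hge
    push Not at hge
    refine hfI (Set.mem_insert_of_mem e ?_)
    rw [hI, Finset.coe_filter]
    exact ⟨hfT, hge⟩
  have hind2 : M.Indep (insert e (T : Set α) \ {f}) := (hT.indep.mem_fundCircuit_iff hecl heT').1 hfK
  have hbase : M.IsBase (insert e (T : Set α) \ {f}) := hT.exchange_isBase_of_indep' (Finset.mem_coe.2 hfT) heT' hind2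
  refine ⟨e, f, heT, hfT, hce, hfc, ?_⟩
  have hcoe : ((insert e (T.erase f) : Finset α) : Set α) = insert e (T : Set α) \ {f} := by
    rw [Finset.coe_insert, Finset.coe_erase, Set.insert_sdiff_singleton_comm hfe.symm]
  rw [hcoe]
  exact hbase

/-- **A maximum-weight base meets every upper level set of the weight in a basis of that level set** (for every threshold `c`,
`T ∩ {β ≥ c}` is a maximal independent subset of `{x ∈ E : β x ≥ c}`) — the set form of Oxley's Lemma 1.8.4 «w(e_j) ≥ w(f_j)» /
of the cut–circuit optimality conditions: otherwise the exchange of `exists_isBase_insert_erase_of_not_isBasis` gives a base of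
larger weight. (The tree's `Literature/Combinatorics/Matroid/MinimumWeightBases.lean` has the circuit form for `finsum` weights;
this finset form is what the co-tree monomials below need.) [cite: Oxley2011, §1.8 Lemma 1.8.3–1.8.4 (p.59); KorteVygen2018, Theorem 13.23] -/
theorem isBasis_filter_of_forall_sum_le {T : Finset α} (hT : M.IsBase (T : Set α)) (β : α → ℝ)
    (hmax : ∀ T' : Finset α, M.IsBase (T' : Set α) → ∑ x ∈ T', β x ≤ ∑ x ∈ T, β x) (c : ℝ) :
    M.IsBasis ((T.filter fun x => c ≤ β x : Finset α) : Set α) {x | x ∈ M.E ∧ c ≤ β x} := by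
  by_contra h
  obtain ⟨e, f, heT, hfT, hce, hfc, hB⟩ := exists_isBase_insert_erase_of_not_isBasis hT β c h
  have hsum : ∑ x ∈ insert e (T.erase f), β x = ∑ x ∈ T, β x - β f + β e := by
    rw [Finset.sum_insert (fun h' => heT (Finset.mem_of_mem_erase h')), ← Finset.add_sum_erase T β hfT]
    ring
  have hle := hmax _ hB
  rw [hsum] at hle
  linarith

end Greedy

/-! ## §2 «доминирующее по степени δ дерево»: the δ-dominant 1-trees of an edge list along a ray -/

variable {N V : ℕ} (E : Fin N → Fin (V + 1) × Fin (V + 1))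

/-- **A δ-dominant 1-tree** of the edge list along the ray `z_l ≍ δ^{β_l}` (Volkov §5.2 «доминирующее по степени δ дерево»): a
spanning tree whose chord monomial `Π_{l ∉ T} z_l ≍ δ^{Σ_{l∉T} β_l}` carries the LEAST power of `δ`, i.e. whose co-tree weight
`Σ_{l ∉ T} β_l` is minimal among all spanning trees (equivalently, by `isDominantTree_iff_forall_sum_le`, whose own weight is
maximal). [cite: Volkov2016, §5.2 p.1175 (PDF p.12 L92–L94) and p.1176–1177 (PDF p.13 L106 – p.14 L6: «доминирующих по степени δ деревьев»)] -/
def IsDominantTree (β : Fin N → ℝ) (T : Finset (Fin N)) : Prop :=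
  IsSpanningTree E T ∧ ∀ T', IsSpanningTree E T' → ∑ e ∈ Tᶜ, β e ≤ ∑ e ∈ T'ᶜ, β e

variable {E}

/-- Co-tree weight and tree weight add up to the total weight. Plumbing. [folklore] -/
private theorem sum_compl_add_sum (β : Fin N → ℝ) (T : Finset (Fin N)) :
    ∑ e ∈ Tᶜ, β e + ∑ e ∈ T, β e = ∑ e, β e := by
  rw [add_comm]
  exact Finset.sum_add_sum_compl T β

/-- Dominant = maximal tree weight (the total weight is fixed). [cite: Volkov2016, §5.2 p.1175 (PDF p.12 L92–L94)] -/
theorem isDominantTree_iff_forall_sum_le (β : Fin N → ℝ) (T : Finset (Fin N)) :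
    IsDominantTree E β T ↔ IsSpanningTree E T ∧ ∀ T', IsSpanningTree E T' → ∑ e ∈ T', β e ≤ ∑ e ∈ T, β e := by
  unfold IsDominantTree
  refine and_congr Iff.rfl (forall_congr' fun T' => imp_congr Iff.rfl ?_)
  have h1 := sum_compl_add_sum β T
  have h2 := sum_compl_add_sum β T'
  constructor <;> intro h <;> linarith

/-- **A dominant tree meets every upper level set `{l : β_l ≥ c}` in a maximal spanning forest of it** (`|T ∩ {β ≥ c}| =
rk{β ≥ c}`): §1 in the cycle matroid, whose bases are the spanning trees. [cite: Volkov2016, §5.2 p.1175 (PDF p.12 L92–L94); Oxley2011, §1.8 Lemma 1.8.3–1.8.4 (p.59)] -/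
theorem IsDominantTree.card_inter_level_eq {β : Fin N → ℝ} {T : Finset (Fin N)} (hT : IsDominantTree E β T) (c : ℝ) :
    (T ∩ univ.filter fun e => c ≤ β e).card = edgeRank E (univ.filter fun e => c ≤ β e) := by
  have hconn : IsConnectedEdgeList E := hT.1.isConnectedEdgeList
  rw [isDominantTree_iff_forall_sum_le] at hT
  have hbase : (cycleMatroid E).IsBase (T : Set (Fin N)) := (isBase_cycleMatroid_iff_isSpanningTree E hconn T).2 hT.1
  have hmax : ∀ T' : Finset (Fin N), (cycleMatroid E).IsBase (T' : Set (Fin N)) → ∑ x ∈ T', β x ≤ ∑ x ∈ T, β x :=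
    fun T' hT' => hT.2 T' ((isBase_cycleMatroid_iff_isSpanningTree E hconn T').1 hT')
  have h := isBasis_filter_of_forall_sum_le hbase β hmax c
  have hset : {x | x ∈ (cycleMatroid E).E ∧ c ≤ β x} = ((univ.filter fun e => c ≤ β e : Finset (Fin N)) : Set (Fin N)) := by
    ext x
    simp
  rw [hset, isBasis_cycleMatroid_iff] at h
  have heq : T.filter (fun x => c ≤ β x) = T ∩ univ.filter fun e => c ≤ β e := by
    ext x
    simp
  rw [← heq]
  exact h.2.2

/-- `edgeRank` is monotone (rank in the cycle matroid). Plumbing. [folklore] -/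
private theorem edgeRank_mono' {A B : Finset (Fin N)} (h : A ⊆ B) : edgeRank E A ≤ edgeRank E B := by
  have hm := (cycleMatroid E).eRk_mono (show (A : Set (Fin N)) ⊆ (B : Set (Fin N)) from Finset.coe_subset.2 h)
  rw [eRk_cycleMatroid_eq_edgeRank, eRk_cycleMatroid_eq_edgeRank] at hm
  exact_mod_cast hm

/-- A subset of an independent line set is independent. Plumbing. [folklore] -/
private theorem edgeRank_eq_card_of_subset' {S T : Finset (Fin N)} (hT : edgeRank E T = T.card) (hST : S ⊆ T) :
    edgeRank E S = S.card := by
  have hind : (cycleMatroid E).Indep (T : Set (Fin N)) := (indep_cycleMatroid_iff_edgeRank E T).2 hT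
  exact (indep_cycleMatroid_iff_edgeRank E S).1 (hind.subset (Finset.coe_subset.2 hST))

/-- **Refinement hypothesis H(γ, c) ⇒ dominant trees meet `γ` in a maximal spanning forest.** If every line outside `γ` has
weight `< c` and the lines of `γ` of weight `≥ c` already span `γ` (`rk{l ∈ γ : β_l ≥ c} = rk γ`), then every δ-dominant tree
`T` has `|T ∩ γ| = rk γ` — Volkov's mechanism «доминирующее по степени δ дерево состоит из P₁, P₂ и любого 1-дерева G′» (the
dominant trees restrict to spanning trees of the subgraph). [cite: Volkov2016, §5.2 p.1175 (PDF p.12 L92–L94)] -/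
theorem IsDominantTree.card_inter_eq_edgeRank {β : Fin N → ℝ} {T : Finset (Fin N)} (hT : IsDominantTree E β T)
    {γ : Finset (Fin N)} {c : ℝ} (hoff : ∀ e, e ∉ γ → β e < c)
    (hrank : edgeRank E (γ.filter fun e => c ≤ β e) = edgeRank E γ) :
    (T ∩ γ).card = edgeRank E γ := by
  set L : Finset (Fin N) := univ.filter fun e => c ≤ β e with hL
  have hLγ : L = γ.filter fun e => c ≤ β e := by
    ext e
    simp only [hL, Finset.mem_filter, Finset.mem_univ, true_and]
    constructor
    · intro h
      exact ⟨by_contra fun he => absurd h (not_le.2 (hoff e he)), h⟩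
    · exact fun h => h.2
  have h1 : (T ∩ L).card = edgeRank E L := hT.card_inter_level_eq c
  have hTree : IsSpanningTree E T := hT.1
  have hTrk : edgeRank E T = T.card := by rw [hTree.2, hTree.1]
  have hsub1 : T ∩ L ⊆ T ∩ γ := by
    intro e he
    rw [Finset.mem_inter] at he ⊢
    rw [hLγ, Finset.mem_filter] at he
    exact ⟨he.1, he.2.1⟩
  have hind1 : edgeRank E (T ∩ γ) = (T ∩ γ).card := edgeRank_eq_card_of_subset' hTrk Finset.inter_subset_left
  have hind2 : edgeRank E (T ∩ L) = (T ∩ L).card := edgeRank_eq_card_of_subset' hTrk Finset.inter_subset_left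
  have hm1 : edgeRank E (T ∩ L) ≤ edgeRank E (T ∩ γ) := edgeRank_mono' hsub1
  have hm2 : edgeRank E (T ∩ γ) ≤ edgeRank E γ := edgeRank_mono' Finset.inter_subset_right
  have hLrk : edgeRank E L = edgeRank E γ := by rw [hLγ, hrank]
  omega

/-! ## §3 Co-tree monomials and Volkov's ray order -/

/-- The co-tree exponent vector `1_{E∖T}` (the multi-index of the chord monomial `Π_{l∉T} z_l`). Plumbing. [folklore] -/
private theorem castExp_cotree_apply (T : Finset (Fin N)) (i : Fin N) :
    castExp (∑ e' ∈ Tᶜ, Finsupp.single e' (1 : ℕ)) i = if i ∈ Tᶜ then 1 else 0 := by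
  unfold castExp
  rw [Finsupp.coe_finsetSum, Finset.sum_apply]
  simp [Finsupp.single_apply, eq_comm]

/-- The power of `δ` carried by the chord monomial of `T` along `z_l = c_l δ^{β_l}` is the co-tree weight `Σ_{l∉T} β_l`.
[cite: Volkov2016, §5.1 (19)–(20) with §5.2 p.1175 (PDF p.12 L92–L94)] -/
theorem linPair_castExp_cotree (T : Finset (Fin N)) (β : Fin N → ℝ) :
    linPair (castExp (∑ e' ∈ Tᶜ, Finsupp.single e' (1 : ℕ))) β = ∑ e ∈ Tᶜ, β e := by
  unfold linPair
  simp_rw [castExp_cotree_apply]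
  rw [← Finset.sum_filter_of_ne (s := univ) (p := fun i => i ∈ Tᶜ) (fun i _ hi => by
    by_contra h; simp [h] at hi)]
  have : univ.filter (fun i => i ∈ Tᶜ) = Tᶜ := by ext i; simp
  rw [this]
  exact Finset.sum_congr rfl fun i hi => by simp [hi]

/-- **The δ-dominant trees are exactly the spanning trees whose chord monomial attains Volkov's ray order of `V`**
(`rayOrder V β = min over the monomials`, all of which are chord monomials of spanning trees).
[cite: Volkov2016, §5.1 (19)–(20) and §5.2 p.1175 (PDF p.12 L92–L94)] -/
theorem isDominantTree_iff_linPair_eq_rayOrder {T : Finset (Fin N)} (hT : IsSpanningTree E T) (β : Fin N → ℝ) :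
    IsDominantTree E β T ↔
      linPair (castExp (∑ e' ∈ Tᶜ, Finsupp.single e' (1 : ℕ))) β = rayOrder (kirchhoffPolynomial ℝ E) β := by
  have hconn : IsConnectedEdgeList E := hT.isConnectedEdgeList
  have hne : kirchhoffPolynomial ℝ E ≠ 0 := kirchhoffPolynomial_ne_zero E ℝ hconn
  rw [rayOrder_eq_inf' hne, linPair_castExp_cotree]
  constructor
  · intro hD
    refine le_antisymm ?_ (Finset.inf'_le_of_le _ (sum_single_compl_mem_support E hT) (by rw [linPair_castExp_cotree]))
    refine Finset.le_inf' _ _ fun d hd => ?_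
    obtain ⟨T', hT', rfl⟩ := exists_isSpanningTree_of_mem_support E hd
    rw [linPair_castExp_cotree]
    exact hD.2 T' hT'
  · intro h
    refine ⟨hT, fun T' hT' => ?_⟩
    rw [h, ← linPair_castExp_cotree T' β]
    exact Finset.inf'_le _ (sum_single_compl_mem_support E hT')

/-! ## §4 Initial forms that only see a sub-polynomial -/

/-- If `q` is a sub-sum of the monomials of `p` (same coefficients on `supp q ⊆ supp p`) containing every `β`-minimal monomial of
`p`, then `p` and `q` have the same initial form along `β` (App. A's «top group 1,…,H» lies inside `q`). [cite: Volkov2016, App. A (p.1185)] -/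
theorem initForm_eq_of_support_subset {n : ℕ} {p q : MvPolynomial (Fin n) ℝ} (β : Fin n → ℝ) (hp : p ≠ 0)
    (hsub : q.support ⊆ p.support) (hcoeff : ∀ d ∈ q.support, coeff d q = coeff d p)
    (hmin : ∀ d ∈ p.support, linPair (castExp d) β = rayOrder p β → d ∈ q.support) :
    initForm p β = initForm q β := by
  have hps : p.support.Nonempty := support_nonempty.2 hp
  obtain ⟨d₀, hd₀, hd₀eq⟩ := Finset.exists_mem_eq_inf' hps fun d => linPair (castExp d) β
  rw [← rayOrder_eq_inf' hp] at hd₀eq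
  have hd₀q : d₀ ∈ q.support := hmin d₀ hd₀ hd₀eq.symm
  have hq : q ≠ 0 := support_nonempty.1 ⟨d₀, hd₀q⟩
  have hord : rayOrder q β = rayOrder p β := by
    rw [rayOrder_eq_inf' hq, rayOrder_eq_inf' hp]
    refine le_antisymm ?_ ?_
    · rw [← rayOrder_eq_inf' hp, hd₀eq]
      exact Finset.inf'_le _ hd₀q
    · exact Finset.le_inf' _ _ fun d hd => Finset.inf'_le _ (hsub hd)
  ext s
  rw [coeff_initForm, coeff_initForm, hord]
  by_cases hs : linPair (castExp s) β = rayOrder p β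
  · rw [if_pos hs, if_pos hs]
    by_cases hsp : s ∈ p.support
    · exact (hcoeff s (hmin s hsp hs)).symm
    · have hsq : s ∉ q.support := fun h => hsp (hsub h)
      rw [notMem_support_iff.1 hsp, notMem_support_iff.1 hsq]
  · rw [if_neg hs, if_neg hs]

/-! ## §5 The subgraph and quotient polynomials `V_{G′}`, `V_{G/G′}` and the factorisation of the initial form of `V` -/

variable (E) in
open scoped Classical in
/-- **`V_{G′}` — the 1-tree polynomial of the subgraph spanned by the line set `γ`** (for a connected `G′`: «сумма по всем
1-деревьям … произведений z_l по всем хордам» inside `G′`; in general the product over the components), written as in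
`KirchhoffFactorization.lean`: the sum over the maximal spanning forests `F` of `γ` (bases of `γ` in the cycle matroid) of
`Π_{l ∈ γ∖F} z_l`. [cite: Volkov2016, §5.1 p.1174 (PDF p.11 L243–L247: «V — сумма по всем 1-деревьям T графа G произведений z_l по всем хордам T») and §5.3 p.1177 (PDF p.14 L21–L31: «V_{G′}, V_{G/G′} строятся по правилам, аналогичным описанным выше»); Brown2017, Lemma 2.1 / Prop. 2.2] -/
def subgraphPolynomial (γ : Finset (Fin N)) : MvPolynomial (Fin N) ℝ :=
  ∑ F ∈ γ.powerset.filter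
      (fun F : Finset (Fin N) => (cycleMatroid E).IsBasis (↑F : Set (Fin N)) (↑γ : Set (Fin N))),
      ∏ e ∈ γ \ F, (X e : MvPolynomial (Fin N) ℝ)

variable (E) in
open scoped Classical in
/-- **`V_{G/G′}` — the 1-tree polynomial of the quotient `G/G′`** («граф, получающийся из G заменой подграфа G′ на вершину»,
footnote 17), written through the cycle matroid: the sum over the bases `T′` of the CONTRACTION `M(G)/γ` (= the spanning trees of
`G/G′` for a connected `G′`, Oxley's `M(G/T) = M(G)/T` — the quotient GRAPH itself is not typed) of `Π_{l ∈ (E∖γ)∖T′} z_l`.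
[cite: Volkov2016, §5.3 p.1177 footnote 17 (PDF p.14 L67–L71) and (PDF p.14 L21–L31); Brown2017, Lemma 2.1 / Prop. 2.2; Oxley2011, §3.1 Prop. 3.1.7] -/
def quotientPolynomial (γ : Finset (Fin N)) : MvPolynomial (Fin N) ℝ :=
  ∑ T' ∈ γᶜ.powerset.filter
      (fun T' : Finset (Fin N) => ((cycleMatroid E).contract (↑γ : Set (Fin N))).IsBase (↑T' : Set (Fin N))),
      ∏ e ∈ γᶜ \ T', (X e : MvPolynomial (Fin N) ℝ)

/-- Brown's factorisation in this notation: the lowest-order part of `V` in the `γ`-variables is `V_{G′} · V_{G/G′}`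
(`KirchhoffFactorization.trunc_kirchhoffPolynomial_neg_setIndicator`). [cite: Brown2017, Prop. 2.2 (arXiv:1512.06409v3 PDF p.16); Schultka2018, Proposition 4.11] -/
theorem trunc_kirchhoffPolynomial_eq_subgraph_mul_quotient (hconn : IsConnectedEdgeList E) (γ : Finset (Fin N)) :
    trunc (kirchhoffPolynomial ℝ E) (-setIndicator γ) = subgraphPolynomial E γ * quotientPolynomial E γ :=
  trunc_kirchhoffPolynomial_neg_setIndicator E hconn γ

/-- **THE REFINEMENT THEOREM.** If every line outside `γ` has weight `< c` and the lines of `γ` of weight `≥ c` span `γ`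
(H(γ, c)), then along `z_l = c_l δ^{β_l}` the initial form (δ-leading part) of `V` equals that of `V_{G′} · V_{G/G′}`: every
δ-dominant tree meets `γ` in a maximal forest (§2), so the dominant chord monomials all lie in Brown's lowest-order part
`V_{G′} V_{G/G′}` of `V` (§5), which has the same coefficients there. This is the combinatorial content of Volkov's «если все
величины … V … расписать в виде суммы произведений, оставить только доминирующие по степени δ слагаемые, то мы получим точные
равенства» for the 1-tree polynomial. [cite: Volkov2016, §5.3 p.1177 (PDF p.15 L56–L91, eq. (24) first relation and the sentence after (25)); Brown2017, Prop. 2.2] -/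
theorem initForm_kirchhoffPolynomial_eq_of_level (hconn : IsConnectedEdgeList E) (β : Fin N → ℝ) {γ : Finset (Fin N)}
    {c : ℝ} (hoff : ∀ e, e ∉ γ → β e < c) (hrank : edgeRank E (γ.filter fun e => c ≤ β e) = edgeRank E γ) :
    initForm (kirchhoffPolynomial ℝ E) β = initForm (subgraphPolynomial E γ * quotientPolynomial E γ) β := by
  classical
  have hne : kirchhoffPolynomial ℝ E ≠ 0 := kirchhoffPolynomial_ne_zero E ℝ hconn
  rw [← trunc_kirchhoffPolynomial_eq_subgraph_mul_quotient hconn γ]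
  refine initForm_eq_of_support_subset β hne ?_ ?_ ?_
  · -- `supp V|_F ⊆ supp V`
    intro d hd
    rw [MvPolynomial.mem_support_iff, coeff_trunc] at hd
    by_contra h
    exact hd (if_neg fun h' => h h'.1)
  · -- same coefficients on the face
    intro d hd
    rw [MvPolynomial.mem_support_iff, coeff_trunc] at hd
    rw [coeff_trunc]
    by_cases h : d ∈ (kirchhoffPolynomial ℝ E).support ∧
        pairing (-setIndicator γ) d = faceValue (kirchhoffPolynomial ℝ E) (-setIndicator γ)
    · rw [if_pos h]
    · exact absurd (if_neg h) hd
  · -- every dominant chord monomial lies on Brown's face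
    intro d hd hmin
    obtain ⟨T, hT, rfl⟩ := exists_isSpanningTree_of_mem_support E hd
    have hdom : IsDominantTree E β T := (isDominantTree_iff_linPair_eq_rayOrder hT β).2 hmin
    have hcard : (T ∩ γ).card = edgeRank E γ := hdom.card_inter_eq_edgeRank hoff hrank
    have hγ : ((γ \ T).card : ℝ) = loopNumber E γ := by
      exact_mod_cast ((loopNumber_le_card_sdiff_of_isSpanningTree E hT γ).2).2 hcard
    have hsum : ∑ e ∈ γ, (((∑ e' ∈ Tᶜ, Finsupp.single e' (1 : ℕ) : Fin N →₀ ℕ) e : ℕ) : ℝ) = ((γ \ T).card : ℝ) := by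
      have h1 : ∀ e ∈ γ, (((∑ e' ∈ Tᶜ, Finsupp.single e' (1 : ℕ) : Fin N →₀ ℕ) e : ℕ) : ℝ) =
          if e ∈ Tᶜ then (1 : ℝ) else 0 := fun e _ => castExp_cotree_apply T e
      rw [Finset.sum_congr rfl h1, Finset.sum_boole]
      congr 2
      ext e
      simp [Finset.mem_sdiff]
    exact ((card_sdiff_of_mem_support_kirchhoffPolynomial E hd γ).2).1 (by rw [hsum, hγ])

/-! ## §6 V16 §5.3 (24), first relation: «V_{G′} V_{G/G′} ∼ V» on the IR vector -/

/-- **Asymptotic equivalence from equal initial forms** (footnote 16: «f ∼ g означает lim f/g = 1»): if `f` and `g` have the same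
initial form along `β` and it does not vanish at the base point `c`, then `f(z(δ))/g(z(δ)) → 1` as `δ → 0⁺` along
`z_i = c_i δ^{β_i}`. [cite: Volkov2016, §5.2 footnote 16 (p.1175, PDF p.12 L97–L99) with App. A (p.1185)] -/
theorem tendsto_div_one_of_initForm_eq {n : ℕ} {f g : MvPolynomial (Fin n) ℝ} (β c : Fin n → ℝ)
    (h : initForm f β = initForm g β) (hg : eval c (initForm g β) ≠ 0) :
    Tendsto (fun δ : ℝ => eval (rayPath c β δ) f / eval (rayPath c β δ) g) (𝓝[>] 0) (𝓝 1) := by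
  have hg0 : g ≠ 0 := by
    rintro rfl
    apply hg
    simp [initForm]
  have hf0 : f ≠ 0 := by
    rintro rfl
    apply hg
    rw [← h]
    simp [initForm]
  -- equal initial forms have equal orders
  have hord : rayOrder f β = rayOrder g β := by
    have hsupp : (initForm g β).support.Nonempty := support_nonempty.2 (initForm_ne_zero hg0 β)
    obtain ⟨d, hd⟩ := hsupp
    have hdg := hd
    rw [support_initForm, Finset.mem_filter] at hdg
    rw [← h, support_initForm, Finset.mem_filter] at hd
    rw [← hd.2, hdg.2]
  have hF := tendsto_rpow_neg_rayOrder_mul_eval f β c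
  have hG := tendsto_rpow_neg_rayOrder_mul_eval g β c
  rw [hord] at hF
  rw [h] at hF
  have hdiv := hF.div hG hg
  rw [div_self hg] at hdiv
  refine (tendsto_congr' ?_).1 hdiv
  filter_upwards [self_mem_nhdsWithin] with δ (hδ : 0 < δ)
  have hpow : δ ^ (-rayOrder g β) ≠ 0 := (Real.rpow_pos_of_pos hδ _).ne'
  simp only [Pi.div_apply]
  rw [mul_div_mul_left _ _ hpow]
  rfl

/-- **H(γ, c) ⇒ «V_{G′} V_{G/G′} ∼ V»** along every monomial path `z_l = c_l δ^{β_l}` with `c_l > 0`: the ratio tends to `1` as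
`δ → 0⁺`. [cite: Volkov2016, §5.3 (24) first relation (p.1177, PDF p.15 L67–L71) with footnote 16 (PDF p.12 L97–L99)] -/
theorem tendsto_subgraph_mul_quotient_div_of_level (hconn : IsConnectedEdgeList E) (β : Fin N → ℝ) {γ : Finset (Fin N)}
    {c : ℝ} (hoff : ∀ e, e ∉ γ → β e < c) (hrank : edgeRank E (γ.filter fun e => c ≤ β e) = edgeRank E γ)
    (x : Fin N → ℝ) (hx : ∀ i, 0 < x i) :
    Tendsto (fun δ : ℝ => eval (rayPath x β δ) (subgraphPolynomial E γ * quotientPolynomial E γ) /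
        eval (rayPath x β δ) (kirchhoffPolynomial ℝ E)) (𝓝[>] 0) (𝓝 1) :=
  tendsto_div_one_of_initForm_eq β x (initForm_kirchhoffPolynomial_eq_of_level hconn β hoff hrank).symm
    (eval_initForm_kirchhoffPolynomial_pos E hconn β hx).ne'

/-- **The IR vector of §5.2** «β_j = 2 для линий из G′, β_j = 1 для линий из P₁ и P₂, β_j = 0 для остальных линий», as the
two-level vector `𝟙_γ + 𝟙_{γ ∪ P}` (`γ` = the lines of `G′`, `P` = the lines of `P₁ ∪ P₂`): it is `2` on `γ`, at most `1` off `γ`.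
[cite: Volkov2016, §5.2 p.1175 (PDF p.12 L81–L85)] -/
theorem irVector_apply_of_mem {γ P : Finset (Fin N)} {e : Fin N} (he : e ∈ γ) :
    setIndicator γ e + setIndicator (γ ∪ P) e = 2 := by
  norm_num [setIndicator, he]

/-- Off `G′` the IR vector is `≤ 1 < 2`. [cite: Volkov2016, §5.2 p.1175 (PDF p.12 L81–L85)] -/
theorem irVector_apply_lt_two_of_not_mem {γ P : Finset (Fin N)} {e : Fin N} (he : e ∉ γ) :
    setIndicator γ e + setIndicator (γ ∪ P) e < 2 := by
  by_cases hP : e ∈ P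
  · norm_num [setIndicator, he, hP]
  · norm_num [setIndicator, he, hP]

/-- **V16 §5.3 (24), first relation, polynomial form**: along the IR vector of §5.2 the initial form of `V` is the initial form
of `V_{G′} · V_{G/G′}` — for EVERY connected edge list, EVERY line set `γ` («G′») and EVERY `P` («P₁ ∪ P₂»); no hypothesis on
how `P` hangs off `G′` is needed for this relation (it is needed only for the VALUE `N_{G′} − 1` of the order,
`OneTreePolynomialRayOrder.rayOrder_kirchhoffPolynomial_irVector`). [cite: Volkov2016, §5.3 (24) first relation (p.1177, PDF p.15 L56–L71) and «оставить только доминирующие по степени δ слагаемые, то мы получим точные равенства» (PDF p.15 L88–L91)] -/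
theorem initForm_kirchhoffPolynomial_irVector_eq (hconn : IsConnectedEdgeList E) (γ P : Finset (Fin N)) :
    initForm (kirchhoffPolynomial ℝ E) (fun e => setIndicator γ e + setIndicator (γ ∪ P) e) =
      initForm (subgraphPolynomial E γ * quotientPolynomial E γ) (fun e => setIndicator γ e + setIndicator (γ ∪ P) e) := by
  refine initForm_kirchhoffPolynomial_eq_of_level hconn _ (c := 2) (fun e he => irVector_apply_lt_two_of_not_mem he) ?_
  congr 1
  ext e
  simp only [Finset.mem_filter, and_iff_left_iff_imp]
  intro he
  rw [irVector_apply_of_mem he]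

/-- **V16 §5.3 (24), first relation, as printed: «V_{G′} V_{G/G′} ∼ V»** — along `z_l = c_l δ^{β_l}` with `β` the IR vector of
§5.2 (2 on the lines of `G′`, 1 on `P₁ ∪ P₂`, 0 elsewhere) and any `c_l > 0`, `V_{G′}(z)V_{G/G′}(z) / V(z) → 1` as `δ → 0`
(footnote 16's «∼»), for every connected edge list and all line sets `γ`, `P`. NOT CLAIMED here: the other relations of (24)
(`B`, `Q̂` blocks) and (25) (`W/V`), the multi-subgraph chains of App. C (which need the same refinement step for quotient blocks
`V_{G_b/G_a}`), and that a given QED graph's `G′`, `P₁`, `P₂` are as in §5.2. [cite: Volkov2016, §5.3 (24) first relation (p.1177, PDF p.15 L56–L71) with footnote 16 (p.1175, PDF p.12 L97–L99) and footnote 17 (PDF p.14 L67–L71)] -/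
theorem tendsto_subgraph_mul_quotient_div_irVector (hconn : IsConnectedEdgeList E) (γ P : Finset (Fin N))
    (x : Fin N → ℝ) (hx : ∀ i, 0 < x i) :
    Tendsto (fun δ : ℝ =>
        eval (rayPath x (fun e => setIndicator γ e + setIndicator (γ ∪ P) e) δ) (subgraphPolynomial E γ * quotientPolynomial E γ) /
        eval (rayPath x (fun e => setIndicator γ e + setIndicator (γ ∪ P) e) δ) (kirchhoffPolynomial ℝ E))
      (𝓝[>] 0) (𝓝 1) :=
  tendsto_div_one_of_initForm_eq _ x (initForm_kirchhoffPolynomial_irVector_eq hconn γ P).symm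
    (eval_initForm_kirchhoffPolynomial_pos E hconn _ hx).ne'

/-! ## §7 Initial forms are multiplicative (a real polynomial ring has no zero divisors)

Needed to carry the refinement theorem through PRODUCTS of blocks (App. C's chains `V_{G_{i₁}/G_{i₀}} ⋯ V_{G_{i_r}/G_{i_{r−1}}}`):
the δ-leading part of a product is the product of the δ-leading parts, and the orders add. -/

section InitFormMul

variable {n : ℕ}

/-- `castExp` is additive. Plumbing. [folklore] -/
private theorem castExp_add (a b : Fin n →₀ ℕ) : castExp (a + b) = castExp a + castExp b := by
  funext i
  simp [castExp, Finsupp.add_apply, Nat.cast_add]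

/-- `linPair` is additive in the exponent. Plumbing. [folklore] -/
private theorem linPair_add_left (p q β : Fin n → ℝ) : linPair (p + q) β = linPair p β + linPair q β := by
  unfold linPair
  rw [← Finset.sum_add_distrib]
  exact Finset.sum_congr rfl fun i _ => by rw [Pi.add_apply, add_mul]

/-- Every monomial has order at least the ray order. Plumbing. [cite: Volkov2016, App. A (p.1185)] -/
private theorem rayOrder_le_of_mem {P : MvPolynomial (Fin n) ℝ} {d : Fin n →₀ ℕ} (hd : d ∈ P.support) (β : Fin n → ℝ) :
    rayOrder P β ≤ linPair (castExp d) β := by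
  have hP : P ≠ 0 := fun h => by simp [h] at hd
  rw [rayOrder_eq_inf' hP]
  exact Finset.inf'_le _ hd

/-- The coefficients of `in(p) · in(q)`: zero off the weight `ord p + ord q`, equal to those of `p · q` on it. Plumbing. [folklore] -/
private theorem coeff_initForm_mul_initForm (p q : MvPolynomial (Fin n) ℝ) (β : Fin n → ℝ) (d : Fin n →₀ ℕ) :
    coeff d (initForm p β * initForm q β) =
      if linPair (castExp d) β = rayOrder p β + rayOrder q β then coeff d (p * q) else 0 := by
  rw [coeff_mul, coeff_mul]
  split_ifs with hd
  · refine Finset.sum_congr rfl fun x hx => ?_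
    rw [Finset.HasAntidiagonal.mem_antidiagonal] at hx
    rw [coeff_initForm, coeff_initForm]
    by_cases h1 : x.1 ∈ p.support
    · by_cases h2 : x.2 ∈ q.support
      · have hw1 := rayOrder_le_of_mem h1 β
        have hw2 := rayOrder_le_of_mem h2 β
        have hsum : linPair (castExp x.1) β + linPair (castExp x.2) β = rayOrder p β + rayOrder q β := by
          rw [← linPair_add_left, ← castExp_add, hx, hd]
        rw [if_pos (by linarith), if_pos (by linarith)]
      · rw [notMem_support_iff.1 h2]
        simp
    · rw [notMem_support_iff.1 h1]
      simp
  · refine Finset.sum_eq_zero fun x hx => ?_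
    rw [Finset.HasAntidiagonal.mem_antidiagonal] at hx
    rw [coeff_initForm, coeff_initForm]
    by_cases h1 : linPair (castExp x.1) β = rayOrder p β
    · by_cases h2 : linPair (castExp x.2) β = rayOrder q β
      · exfalso
        apply hd
        rw [← hx, castExp_add, linPair_add_left, h1, h2]
      · rw [if_neg h2, mul_zero]
    · rw [if_neg h1, zero_mul]

/-- **Orders add under multiplication**: `rayOrder (p·q) β = rayOrder p β + rayOrder q β` for non-zero real polynomials (the
δ-dominant monomials of `in(p)·in(q)` do not all cancel, `ℝ[z]` having no zero divisors). [cite: Volkov2016, §5.1 (19)–(20) with App. A (p.1185)] -/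
theorem rayOrder_mul {p q : MvPolynomial (Fin n) ℝ} (hp : p ≠ 0) (hq : q ≠ 0) (β : Fin n → ℝ) :
    rayOrder (p * q) β = rayOrder p β + rayOrder q β := by
  have hpq : p * q ≠ 0 := mul_ne_zero hp hq
  refine le_antisymm ?_ ?_
  · have hne : initForm p β * initForm q β ≠ 0 := mul_ne_zero (initForm_ne_zero hp β) (initForm_ne_zero hq β)
    obtain ⟨d, hd⟩ := ne_zero_iff.1 hne
    rw [coeff_initForm_mul_initForm] at hd
    by_cases h : linPair (castExp d) β = rayOrder p β + rayOrder q β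
    · rw [if_pos h] at hd
      rw [← h]
      exact rayOrder_le_of_mem (mem_support_iff.2 hd) β
    · rw [if_neg h] at hd
      exact absurd rfl hd
  · rw [rayOrder_eq_inf' hpq]
    refine Finset.le_inf' _ _ fun d hd => ?_
    obtain ⟨a, ha, b, hb, rfl⟩ := Finset.mem_add.1 (support_mul p q hd)
    rw [castExp_add, linPair_add_left]
    exact add_le_add (rayOrder_le_of_mem ha β) (rayOrder_le_of_mem hb β)

/-- **Initial forms are multiplicative**: `in(p·q) = in(p) · in(q)` along every `β` for non-zero real polynomials — the δ-leading
part of a product of blocks is the product of their δ-leading parts (how (24)'s relations combine in the products `F^{G′}F^{G/G′}`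
and in App. C's chains). [cite: Volkov2016, §5.3 p.1177 (PDF p.15 L88–L91) with App. A (p.1185)] -/
theorem initForm_mul {p q : MvPolynomial (Fin n) ℝ} (hp : p ≠ 0) (hq : q ≠ 0) (β : Fin n → ℝ) :
    initForm (p * q) β = initForm p β * initForm q β := by
  ext d
  rw [coeff_initForm, coeff_initForm_mul_initForm, rayOrder_mul hp hq]

/-- Refining one FACTOR: if `X` and `Y` have the same initial form, so do `R·X` and `R·Y` (all non-zero). [cite: Volkov2016, §5.3 p.1177 (PDF p.15 L88–L91)] -/
theorem initForm_mul_congr_right {R X Y : MvPolynomial (Fin n) ℝ} (hR : R ≠ 0) (hX : X ≠ 0) (hY : Y ≠ 0) (β : Fin n → ℝ)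
    (h : initForm X β = initForm Y β) : initForm (R * X) β = initForm (R * Y) β := by
  rw [initForm_mul hR hX, initForm_mul hR hY, h]

/-- The initial form at a point of the positive orthant is positive for a non-zero polynomial with non-negative coefficients
(no cancellation among the dominant monomials). [cite: Volkov2016, §5.1 Утверждение 1 (positive-coefficient denominators) with App. A (p.1185)] -/
theorem eval_initForm_pos_of_coeff_nonneg {p : MvPolynomial (Fin n) ℝ} (hp : p ≠ 0) (hcoeff : ∀ d ∈ p.support, 0 ≤ coeff d p)
    (β : Fin n → ℝ) {c : Fin n → ℝ} (hc : ∀ i, 0 < c i) : 0 < eval c (initForm p β) := by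
  have hsupp : (initForm p β).support.Nonempty := support_nonempty.2 (initForm_ne_zero hp β)
  rw [eval_initForm, ← support_initForm]
  refine Finset.sum_pos (fun r hr => ?_) hsupp
  have hr' := hr
  rw [support_initForm, Finset.mem_filter] at hr'
  have hpos : 0 < coeff r p := lt_of_le_of_ne (hcoeff r hr'.1) (Ne.symm (mem_support_iff.1 hr'.1))
  exact mul_pos hpos (Finset.prod_pos fun i _ => pow_pos (hc i) _)

end InitFormMul

/-! ## §8 The 1-tree polynomial of a MINOR of the cycle matroid — App. C's blocks `V_{G_b/G_a}`

Volkov's blocks `V_{G′}`, `V_{G/G′}`, and in Приложение C `V_{G_{i_s}/G_{i_{s−1}}}` for a nested chain `G₁ ⊂ G₂ ⊂ … ⊂ G_n ⊂ G`, are the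
1-tree polynomials of subgraphs of quotients, i.e. — through Oxley's dictionary `M(G/T) = M(G)/T`, bases ↔ spanning trees — the
basis (co-)generating polynomials of MINORS `(M(G)|G_b)/G_a` of the cycle matroid. They are typed here for an arbitrary matroid on the
line set `Fin N`, so that the refinement theorem can be iterated inside blocks. -/

section Minor

variable {N : ℕ}

open scoped Classical in
/-- The line set `E(M)` of a matroid on `Fin N`, as a finset. [cite: Oxley2011, §1.1 (the ground set E(M))] -/
def groundLines (M : Matroid (Fin N)) : Finset (Fin N) := univ.filter fun e => e ∈ M.E

/-- Membership in `groundLines`. [cite: Oxley2011, §1.1] -/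
@[simp] theorem mem_groundLines {M : Matroid (Fin N)} {e : Fin N} : e ∈ groundLines M ↔ e ∈ M.E := by
  simp [groundLines]

/-- `groundLines` as a set is the ground set. [cite: Oxley2011, §1.1] -/
theorem coe_groundLines (M : Matroid (Fin N)) : (groundLines M : Set (Fin N)) = M.E := by
  ext e
  simp

open scoped Classical in
/-- The bases of a matroid on `Fin N`, as a finset of finsets. [cite: Oxley2011, §1.2 (bases)] -/
def baseFinsets (M : Matroid (Fin N)) : Finset (Finset (Fin N)) :=
  (groundLines M).powerset.filter fun B : Finset (Fin N) => M.IsBase (B : Set (Fin N))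

/-- Membership in `baseFinsets`. [cite: Oxley2011, §1.2] -/
theorem mem_baseFinsets {M : Matroid (Fin N)} {B : Finset (Fin N)} : B ∈ baseFinsets M ↔ M.IsBase (B : Set (Fin N)) := by
  classical
  simp only [baseFinsets, Finset.mem_filter, Finset.mem_powerset, and_iff_right_iff_imp]
  intro hB e he
  exact mem_groundLines.2 (hB.subset_ground (Finset.mem_coe.2 he))

/-- A base lies inside the line set. Plumbing. [cite: Oxley2011, §1.2] -/
theorem subset_groundLines_of_mem_baseFinsets {M : Matroid (Fin N)} {B : Finset (Fin N)} (hB : B ∈ baseFinsets M) :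
    B ⊆ groundLines M := fun _ he => mem_groundLines.2 ((mem_baseFinsets.1 hB).subset_ground (Finset.mem_coe.2 he))

/-- The multi-index `𝟙_S` of the square-free monomial `Π_{e∈S} z_e`. [folklore] -/
private theorem sumSingle_apply (S : Finset (Fin N)) (i : Fin N) :
    (∑ e ∈ S, Finsupp.single e (1 : ℕ) : Fin N →₀ ℕ) i = if i ∈ S then 1 else 0 := by
  rw [Finsupp.coe_finsetSum, Finset.sum_apply]
  simp [Finsupp.single_apply, eq_comm]

/-- Its support is `S`. [folklore] -/
private theorem support_sumSingle (S : Finset (Fin N)) : (∑ e ∈ S, Finsupp.single e (1 : ℕ) : Fin N →₀ ℕ).support = S := by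
  ext e
  rw [Finsupp.mem_support_iff, sumSingle_apply]
  simp

/-- `S ↦ 𝟙_S` is injective. [folklore] -/
private theorem sumSingle_injective :
    Function.Injective (fun S : Finset (Fin N) => (∑ e ∈ S, Finsupp.single e (1 : ℕ) : Fin N →₀ ℕ)) := by
  intro S T h
  have h' := congrArg Finsupp.support h
  simp only [support_sumSingle] at h'
  exact h'

/-- `Π_{e∈S} X_e = X^{𝟙_S}`. [folklore] -/
private theorem prod_X_eq_monomial_sumSingle (S : Finset (Fin N)) :
    ∏ e ∈ S, (X e : MvPolynomial (Fin N) ℝ) = monomial (∑ e ∈ S, Finsupp.single e 1) 1 := by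
  classical
  induction S using Finset.induction_on with
  | empty => simp
  | insert e S he ih =>
    rw [Finset.prod_insert he, Finset.sum_insert he, ih, ← pow_one (X e), X_pow_eq_monomial, monomial_mul, one_mul]

/-- The power of `δ` carried by `Π_{e∈S} z_e` along `z_e = c_e δ^{β_e}` is `Σ_{e∈S} β_e`. [cite: Volkov2016, §5.1 (19)–(20)] -/
theorem linPair_castExp_sumSingle (S : Finset (Fin N)) (β : Fin N → ℝ) :
    linPair (castExp (∑ e ∈ S, Finsupp.single e (1 : ℕ))) β = ∑ e ∈ S, β e := by
  unfold linPair castExp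
  simp_rw [sumSingle_apply]
  rw [← Finset.sum_filter_of_ne (s := univ) (p := fun i => i ∈ S) (fun i _ hi => by
    by_contra h; simp [h] at hi)]
  have : univ.filter (fun i => i ∈ S) = S := by ext i; simp
  rw [this]
  exact Finset.sum_congr rfl fun i hi => by simp [hi]

/-- The coefficients of a sum of DISTINCT square-free monomials: `1` on the family, `0` off it. [folklore] -/
private theorem coeff_sum_monomial_sumSingle {ι : Type*} (S : Finset ι) (f : ι → Finset (Fin N)) (hf : Set.InjOn f S)
    (d : Fin N →₀ ℕ) :
    coeff d (∑ i ∈ S, (monomial (∑ e ∈ f i, Finsupp.single e 1) (1 : ℝ) : MvPolynomial (Fin N) ℝ)) =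
      if d ∈ S.image (fun i => (∑ e ∈ f i, Finsupp.single e (1 : ℕ) : Fin N →₀ ℕ)) then 1 else 0 := by
  classical
  rw [coeff_sum]
  simp only [coeff_monomial]
  by_cases h : d ∈ S.image (fun i => (∑ e ∈ f i, Finsupp.single e (1 : ℕ) : Fin N →₀ ℕ))
  · rw [if_pos h]
    obtain ⟨i₀, hi₀, rfl⟩ := Finset.mem_image.1 h
    rw [Finset.sum_eq_single_of_mem i₀ hi₀ (fun j hj hji => if_neg fun hEq =>
      hji (hf hj hi₀ (sumSingle_injective hEq)))]
    rw [if_pos rfl]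
  · rw [if_neg h]
    refine Finset.sum_eq_zero fun i hi => if_neg fun hEq => h ?_
    exact Finset.mem_image.2 ⟨i, hi, hEq⟩

open scoped Classical in
/-- **`V_M` — the 1-tree polynomial of a minor**: for a matroid `M` on the lines `Fin N`, `Σ_{B base of M} Π_{e ∈ E(M) ∖ B} z_e`
(for `M = M(G)`, `G` connected: Volkov's `V`; for `M = (M(G)|G_b)/G_a`: the block `V_{G_b/G_a}` of App. C, the 1-tree polynomial
of the quotient of the subgraph `G_b` by `G_a`, spanning trees read as bases through Oxley's `M(G/T) = M(G)/T`).
[cite: Volkov2016, §5.1 p.1174 (PDF p.11 L243–L247), §5.3 p.1177 (PDF p.14 L21–L31) and App. C p.1188–1189 (PDF p.25 L96–L107, p.26 L42–L56); Oxley2011, §3.1 Prop. 3.1.7 / eq. (3.1.2)] -/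
def basisPolynomial (M : Matroid (Fin N)) : MvPolynomial (Fin N) ℝ :=
  ∑ B ∈ baseFinsets M, ∏ e ∈ groundLines M \ B, (X e : MvPolynomial (Fin N) ℝ)

/-- `V_M` as a sum of monomials `X^{𝟙_{E(M)∖B}}`. [cite: Volkov2016, §5.1 p.1174 (PDF p.11 L243–L247)] -/
theorem basisPolynomial_eq_sum_monomial (M : Matroid (Fin N)) :
    basisPolynomial M = ∑ B ∈ baseFinsets M, monomial (∑ e ∈ groundLines M \ B, Finsupp.single e 1) (1 : ℝ) := by
  unfold basisPolynomial
  exact Finset.sum_congr rfl fun B _ => prod_X_eq_monomial_sumSingle _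

/-- `B ↦ E(M) ∖ B` is injective on bases. Plumbing. [cite: Oxley2011, §1.2] -/
theorem sdiff_injOn_baseFinsets (M : Matroid (Fin N)) : Set.InjOn (fun B => groundLines M \ B) (baseFinsets M : Set (Finset (Fin N))) := by
  intro B hB B' hB' h
  have h1 := subset_groundLines_of_mem_baseFinsets (Finset.mem_coe.1 hB)
  have h2 := subset_groundLines_of_mem_baseFinsets (Finset.mem_coe.1 hB')
  have h' : groundLines M \ B = groundLines M \ B' := h
  have : groundLines M \ (groundLines M \ B) = groundLines M \ (groundLines M \ B') := by rw [h']
  rwa [Finset.sdiff_sdiff_eq_self h1, Finset.sdiff_sdiff_eq_self h2] at this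

/-- **Coefficients of `V_M`**: `1` on the co-base monomials, `0` elsewhere. [cite: Volkov2016, §5.1 p.1174 (PDF p.11 L243–L247)] -/
theorem coeff_basisPolynomial (M : Matroid (Fin N)) (d : Fin N →₀ ℕ) :
    coeff d (basisPolynomial M) =
      if d ∈ (baseFinsets M).image (fun B => (∑ e ∈ groundLines M \ B, Finsupp.single e (1 : ℕ) : Fin N →₀ ℕ)) then 1 else 0 := by
  rw [basisPolynomial_eq_sum_monomial]
  exact coeff_sum_monomial_sumSingle (baseFinsets M) (fun B => groundLines M \ B) (sdiff_injOn_baseFinsets M) d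

/-- **Support of `V_M`** = the co-base monomials. [cite: Volkov2016, §5.1 p.1174 (PDF p.11 L243–L247)] -/
theorem support_basisPolynomial (M : Matroid (Fin N)) :
    (basisPolynomial M).support = (baseFinsets M).image (fun B => (∑ e ∈ groundLines M \ B, Finsupp.single e (1 : ℕ) : Fin N →₀ ℕ)) := by
  ext d
  rw [mem_support_iff, coeff_basisPolynomial]
  by_cases h : d ∈ (baseFinsets M).image (fun B => (∑ e ∈ groundLines M \ B, Finsupp.single e (1 : ℕ) : Fin N →₀ ℕ))
  · simp [h]
  · simp [h]

/-- `V_M ≠ 0`: a matroid has a base. [cite: Oxley2011, §1.2 (B1)] -/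
theorem basisPolynomial_ne_zero (M : Matroid (Fin N)) : basisPolynomial M ≠ 0 := by
  obtain ⟨B, hB⟩ := M.exists_isBase
  obtain ⟨Bf, rfl⟩ : ∃ Bf : Finset (Fin N), (Bf : Set (Fin N)) = B := ⟨(Set.toFinite B).toFinset, by simp⟩
  rw [ne_zero_iff]
  refine ⟨∑ e ∈ groundLines M \ Bf, Finsupp.single e 1, ?_⟩
  rw [coeff_basisPolynomial, if_pos (Finset.mem_image.2 ⟨Bf, mem_baseFinsets.2 hB, rfl⟩)]
  exact one_ne_zero

/-- The coefficients of `V_M` are non-negative (all equal to `1` on the support). [cite: Volkov2016, §5.1 p.1174 (PDF p.11 L243–L247)] -/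
theorem coeff_basisPolynomial_nonneg (M : Matroid (Fin N)) (d : Fin N →₀ ℕ) : 0 ≤ coeff d (basisPolynomial M) := by
  rw [coeff_basisPolynomial]
  split_ifs <;> norm_num

/-- The initial form of `V_M` is positive on the open positive orthant. [cite: Volkov2016, §5.2 footnote 16 (PDF p.12 L97–L99) with App. A (p.1185)] -/
theorem eval_initForm_basisPolynomial_pos (M : Matroid (Fin N)) (β : Fin N → ℝ) {c : Fin N → ℝ} (hc : ∀ i, 0 < c i) :
    0 < eval c (initForm (basisPolynomial M) β) :=
  eval_initForm_pos_of_coeff_nonneg (basisPolynomial_ne_zero M) (fun d _ => coeff_basisPolynomial_nonneg M d) β hc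

/-! ### The three blocks of §5: `V = V_{M(G)}`, `V_{G′} = V_{M(G)|γ}`, `V_{G/G′} = V_{M(G)/γ}` -/

variable {V : ℕ} (E : Fin N → Fin (V + 1) × Fin (V + 1))

/-- The cycle matroid lives on all lines. [folklore] -/
private theorem groundLines_cycleMatroid : groundLines (cycleMatroid E) = univ := by
  ext e
  simp

/-- The lines of a restriction. [cite: Oxley2011, §1.3 (restriction M|X)] -/
theorem groundLines_restrict (M : Matroid (Fin N)) (R : Finset (Fin N)) : groundLines (M ↾ (R : Set (Fin N))) = R := by
  ext e
  simp

/-- The lines of a contraction. [cite: Oxley2011, §3.1 (contraction M/T)] -/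
theorem groundLines_contract (M : Matroid (Fin N)) (C : Finset (Fin N)) :
    groundLines (M ／ (C : Set (Fin N))) = groundLines M \ C := by
  ext e
  simp

open scoped Classical in
/-- The bases of the restriction `M|R` are the bases of `R` in `M` (maximal spanning forests of the subgraph). [cite: Oxley2011, §1.3 eq. (1.3.9) (bases of M|X)] -/
theorem baseFinsets_restrict (M : Matroid (Fin N)) {R : Finset (Fin N)} (hR : (R : Set (Fin N)) ⊆ M.E) :
    baseFinsets (M ↾ (R : Set (Fin N))) =
      R.powerset.filter fun F : Finset (Fin N) => M.IsBasis (F : Set (Fin N)) (R : Set (Fin N)) := by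
  classical
  ext F
  rw [mem_baseFinsets, Finset.mem_filter, Finset.mem_powerset, Matroid.isBase_restrict_iff hR]
  constructor
  · intro h
    exact ⟨fun e he => Finset.mem_coe.1 (h.subset (Finset.mem_coe.2 he)), h⟩
  · exact fun h => h.2

/-- **`V_{M(G)} = V`** for a connected edge list (bases = spanning trees). [cite: Volkov2016, §5.1 p.1174 (PDF p.11 L243–L247); Oxley2011, §1.3 (text before eq. 1.3.6)] -/
theorem basisPolynomial_cycleMatroid (hconn : IsConnectedEdgeList E) :
    basisPolynomial (cycleMatroid E) = kirchhoffPolynomial ℝ E := by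
  classical
  rw [kirchhoffPolynomial_eq_sum_spanningTrees, basisPolynomial]
  have hset : baseFinsets (cycleMatroid E) = univ.filter (IsSpanningTree E) := by
    ext T
    rw [mem_baseFinsets, Finset.mem_filter, isBase_cycleMatroid_iff_isSpanningTree E hconn]
    simp
  rw [hset]
  refine Finset.sum_congr rfl fun T _ => ?_
  rw [groundLines_cycleMatroid, Finset.compl_eq_univ_sdiff]

/-- **`V_{M(G)|γ} = V_{G′}`**. [cite: Volkov2016, §5.3 p.1177 (PDF p.14 L21–L31); Oxley2011, §1.3 eq. (1.3.9)] -/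
theorem basisPolynomial_restrict_cycleMatroid (γ : Finset (Fin N)) :
    basisPolynomial (cycleMatroid E ↾ (γ : Set (Fin N))) = subgraphPolynomial E γ := by
  classical
  unfold basisPolynomial subgraphPolynomial
  rw [baseFinsets_restrict _ (by simp), groundLines_restrict]

/-- **`V_{M(G)/γ} = V_{G/G′}`**. [cite: Volkov2016, §5.3 p.1177 footnote 17 (PDF p.14 L67–L71); Oxley2011, §3.1 Prop. 3.1.7] -/
theorem basisPolynomial_contract_cycleMatroid (γ : Finset (Fin N)) :
    basisPolynomial (cycleMatroid E ／ (γ : Set (Fin N))) = quotientPolynomial E γ := by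
  classical
  unfold basisPolynomial quotientPolynomial baseFinsets
  rw [groundLines_contract, groundLines_cycleMatroid, ← Finset.compl_eq_univ_sdiff]

end Minor

/-! ## §9 The refinement theorem for an arbitrary minor: H(C, c) ⇒ `in_β V_M = in_β (V_{M|C} · V_{M/C})` -/

section MinorRefinement

variable {N : ℕ}

/-- **Spanning trees of the quotient = bases of the contraction, read against a maximal forest `F` of `C`**: for `T′ ⊆ E(M) ∖ C`,
`T′` is a base of `M/C` iff `T′ ∪ F` is a base of `M` (Brown's Lemma 2.1 bijection; `KirchhoffFactorization.contract_isBase_iff_of_isBasis`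
for an arbitrary matroid). [cite: Brown2017, Lemma 2.1 (arXiv:1512.06409v3 PDF p.15); Oxley2011, §3.1 Prop. 3.1.7 (bases of a contraction)] -/
theorem contract_isBase_iff_union_isBase {M : Matroid (Fin N)} {F C T' : Finset (Fin N)}
    (hF : M.IsBasis (F : Set (Fin N)) (C : Set (Fin N))) (hT'E : (T' : Set (Fin N)) ⊆ M.E) (hT' : Disjoint T' C) :
    (M ／ (C : Set (Fin N))).IsBase (T' : Set (Fin N)) ↔ M.IsBase ((T' ∪ F : Finset (Fin N)) : Set (Fin N)) := by
  have hdisj : Disjoint (C : Set (Fin N)) (T' : Set (Fin N)) := by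
    rw [Finset.disjoint_coe]; exact hT'.symm
  have hFE : (F : Set (Fin N)) ⊆ M.E := hF.indep.subset_ground
  rw [Finset.coe_union]
  constructor
  · intro hB
    have hind : M.Indep ((T' : Set (Fin N)) ∪ F) := ((hF.contract_indep_iff).1 hB.indep).1
    refine hind.isBase_of_forall_insert fun e he => ?_
    have heTF : e ∉ ((T' : Set (Fin N)) ∪ F) := he.2
    have hsubE : insert e ((T' : Set (Fin N)) ∪ F) ⊆ M.E := Set.insert_subset he.1 (Set.union_subset hT'E hFE)
    by_cases heγ : e ∈ (C : Set (Fin N))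
    · -- `e ∈ C ∖ F`: already `F + e` is dependent
      have hdep : M.Dep (insert e (F : Set (Fin N))) := hF.insert_dep ⟨heγ, fun h => heTF (Or.inr h)⟩
      exact (hdep.superset (Set.insert_subset_insert Set.subset_union_right) hsubE).not_indep
    · -- `e ∉ C`: `T' + e` is dependent in the contraction
      have he' : e ∈ (M ／ (C : Set (Fin N))).E \ (T' : Set (Fin N)) :=
        ⟨⟨he.1, heγ⟩, fun h => heTF (Or.inl h)⟩
      intro hins
      apply (hB.insert_dep he').not_indep
      rw [hF.contract_indep_iff, Set.insert_union]
      exact ⟨hins, Set.disjoint_insert_right.2 ⟨heγ, hdisj⟩⟩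
  · intro hB
    have hind : (M ／ (C : Set (Fin N))).Indep (T' : Set (Fin N)) := (hF.contract_indep_iff).2 ⟨hB.indep, hdisj⟩
    refine hind.isBase_of_forall_insert fun e he => ?_
    rw [Matroid.contract_ground] at he
    intro hins
    have h1 := ((hF.contract_indep_iff).1 hins).1
    rw [Set.insert_union] at h1
    have he' : e ∈ M.E \ ((T' : Set (Fin N)) ∪ F) := by
      refine ⟨he.1.1, ?_⟩
      rintro (h | h)
      · exact he.2 h
      · exact he.1.2 (hF.subset h)
    exact (hB.insert_dep he').not_indep h1

/-- `𝟙_{X ∪ Y} = 𝟙_X + 𝟙_Y` for disjoint `X`, `Y`. [folklore] -/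
private theorem sumSingle_union {X Y : Finset (Fin N)} (h : Disjoint X Y) :
    (∑ e ∈ X ∪ Y, Finsupp.single e (1 : ℕ) : Fin N →₀ ℕ) = (∑ e ∈ X, Finsupp.single e 1) + ∑ e ∈ Y, Finsupp.single e 1 :=
  Finset.sum_union h

open scoped Classical in
/-- **THE REFINEMENT THEOREM FOR A MINOR.** Let `M` be a matroid on the lines `Fin N`, `C ⊆ E(M)`, and `c` a threshold such that
every line of `E(M) ∖ C` has weight `< c` and the lines of `C` of weight `≥ c` SPAN `C` (H(C, c)). Then along `z_l = c_l δ^{β_l}` the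
initial form of `V_M` is that of `V_{M|C} · V_{M/C}`: the δ-dominant bases all meet `C` in a basis (§1), so the dominant monomials
lie in the sub-sum over the bases `B` with `B ∩ C` a basis of `C`, which is `V_{M|C} · V_{M/C}` by Brown's bijection
`B ↦ (B ∩ C, B ∖ C)`. For `M = M(G)` this is `initForm_kirchhoffPolynomial_eq_of_level`; for a block minor `(M(G)|G_b)/G_a` it is
the step «V_{G_b/G_a} ∼ V_{G_s/G_a} V_{G_b/G_s}» of App. C's chains. [cite: Volkov2016, §5.3 (24) (p.1177, PDF p.15 L56–L91) and App. C (p.1189, PDF p.26 L42–L56); Brown2017, Lemma 2.1 / Prop. 2.2] -/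
theorem initForm_basisPolynomial_eq_of_level (M : Matroid (Fin N)) (β : Fin N → ℝ) {C : Finset (Fin N)}
    (hCE : (C : Set (Fin N)) ⊆ M.E) {c : ℝ} (hoff : ∀ e ∈ M.E, e ∉ C → β e < c)
    (hspan : (C : Set (Fin N)) ⊆ M.closure ((C.filter fun e => c ≤ β e : Finset (Fin N)) : Set (Fin N))) :
    initForm (basisPolynomial M) β =
      initForm (basisPolynomial (M ↾ (C : Set (Fin N))) * basisPolynomial (M ／ (C : Set (Fin N)))) β := by
  classical
  have hCg : C ⊆ groundLines M := fun e he => mem_groundLines.2 (hCE (Finset.mem_coe.2 he))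
  -- the face family: bases meeting `C` in a basis of `C`
  set fam : Finset (Finset (Fin N)) :=
    (baseFinsets M).filter fun B => M.IsBasis ((B ∩ C : Finset (Fin N)) : Set (Fin N)) (C : Set (Fin N)) with hfam
  have hfam_sub : fam ⊆ baseFinsets M := Finset.filter_subset _ _
  set q : MvPolynomial (Fin N) ℝ := ∑ B ∈ fam, monomial (∑ e ∈ groundLines M \ B, Finsupp.single e 1) (1 : ℝ) with hq
  have hinj : Set.InjOn (fun B => groundLines M \ B) (fam : Set (Finset (Fin N))) :=
    (sdiff_injOn_baseFinsets M).mono (Finset.coe_subset.2 hfam_sub)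
  -- (A) `q = V_{M|C} · V_{M/C}`
  have hA : q = basisPolynomial (M ↾ (C : Set (Fin N))) * basisPolynomial (M ／ (C : Set (Fin N))) := by
    rw [basisPolynomial_eq_sum_monomial, basisPolynomial_eq_sum_monomial, baseFinsets_restrict M hCE, groundLines_restrict,
      groundLines_contract, Finset.sum_mul_sum, ← Finset.sum_product']
    symm
    refine Finset.sum_nbij' (fun p : Finset (Fin N) × Finset (Fin N) => p.1 ∪ p.2)
      (fun B : Finset (Fin N) => (B ∩ C, B \ C)) ?_ ?_ ?_ ?_ ?_
    · -- (F, T') ↦ F ∪ T' lands in the family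
      rintro ⟨F, T'⟩ hp
      rw [Finset.mem_product] at hp
      obtain ⟨hF, hT'⟩ := hp
      rw [Finset.mem_filter, Finset.mem_powerset] at hF
      have hT'sub : T' ⊆ groundLines M \ C := by
        have h := subset_groundLines_of_mem_baseFinsets hT'
        rwa [groundLines_contract] at h
      have hdisj : Disjoint T' C := Finset.disjoint_left.2 fun e he heC => (Finset.mem_sdiff.1 (hT'sub he)).2 heC
      have hT'E : (T' : Set (Fin N)) ⊆ M.E := fun e he =>
        mem_groundLines.1 (Finset.mem_sdiff.1 (hT'sub (Finset.mem_coe.1 he))).1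
      have hbase : M.IsBase ((T' ∪ F : Finset (Fin N)) : Set (Fin N)) :=
        (contract_isBase_iff_union_isBase hF.2 hT'E hdisj).1 (mem_baseFinsets.1 hT')
      show F ∪ T' ∈ fam
      rw [hfam, Finset.mem_filter, mem_baseFinsets]
      have hinter : (F ∪ T') ∩ C = F := by
        rw [Finset.union_inter_distrib_right, Finset.inter_eq_left.2 hF.1, Finset.disjoint_iff_inter_eq_empty.1 hdisj,
          Finset.union_empty]
      refine ⟨by rw [Finset.union_comm]; exact hbase, ?_⟩
      rw [hinter]
      exact hF.2
    · -- B ↦ (B ∩ C, B ∖ C) lands in (bases of M|C) × (bases of M/C)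
      intro B hB
      rw [hfam, Finset.mem_filter, mem_baseFinsets] at hB
      obtain ⟨hbase, hbasis⟩ := hB
      have hBE : (B : Set (Fin N)) ⊆ M.E := hbase.subset_ground
      rw [Finset.mem_product, Finset.mem_filter, Finset.mem_powerset, mem_baseFinsets]
      refine ⟨⟨Finset.inter_subset_right, hbasis⟩, ?_⟩
      have hdisj : Disjoint (B \ C) C := Finset.sdiff_disjoint
      have hT'E : ((B \ C : Finset (Fin N)) : Set (Fin N)) ⊆ M.E := fun e he =>
        hBE (Finset.mem_coe.2 (Finset.mem_sdiff.1 (Finset.mem_coe.1 he)).1)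
      rw [contract_isBase_iff_union_isBase hbasis hT'E hdisj, Finset.sdiff_union_inter]
      exact hbase
    · -- left inverse
      rintro ⟨F, T'⟩ hp
      rw [Finset.mem_product] at hp
      obtain ⟨hF, hT'⟩ := hp
      rw [Finset.mem_filter, Finset.mem_powerset] at hF
      have hT'sub : T' ⊆ groundLines M \ C := by
        have h := subset_groundLines_of_mem_baseFinsets hT'
        rwa [groundLines_contract] at h
      have hdisj : Disjoint T' C := Finset.disjoint_left.2 fun e he heC => (Finset.mem_sdiff.1 (hT'sub he)).2 heC
      ext1
      · show (F ∪ T') ∩ C = F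
        rw [Finset.union_inter_distrib_right, Finset.inter_eq_left.2 hF.1, Finset.disjoint_iff_inter_eq_empty.1 hdisj,
          Finset.union_empty]
      · show (F ∪ T') \ C = T'
        rw [Finset.union_sdiff_distrib, Finset.sdiff_eq_empty_iff_subset.2 hF.1, Finset.empty_union]
        exact sdiff_eq_left.2 hdisj
    · -- right inverse
      intro B _
      show B ∩ C ∪ B \ C = B
      rw [Finset.union_comm, Finset.sdiff_union_inter]
    · -- the monomials agree
      rintro ⟨F, T'⟩ hp
      rw [Finset.mem_product] at hp
      obtain ⟨hF, hT'⟩ := hp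
      rw [Finset.mem_filter, Finset.mem_powerset] at hF
      have hT'sub : T' ⊆ groundLines M \ C := by
        have h := subset_groundLines_of_mem_baseFinsets hT'
        rwa [groundLines_contract] at h
      have hsplit : groundLines M \ (F ∪ T') = (C \ F) ∪ ((groundLines M \ C) \ T') := by
        ext e
        simp only [Finset.mem_union, Finset.mem_sdiff, not_or]
        constructor
        · rintro ⟨heG, heF, heT'⟩
          by_cases heC : e ∈ C
          · exact Or.inl ⟨heC, heF⟩
          · exact Or.inr ⟨⟨heG, heC⟩, heT'⟩
        · rintro (⟨heC, heF⟩ | ⟨⟨heG, heC⟩, heT'⟩)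
          · exact ⟨hCg heC, heF, fun h => (Finset.mem_sdiff.1 (hT'sub h)).2 heC⟩
          · exact ⟨heG, fun h => heC (hF.1 h), heT'⟩
      have hdisj : Disjoint (C \ F) ((groundLines M \ C) \ T') :=
        Finset.disjoint_left.2 fun e he he' => (Finset.mem_sdiff.1 (Finset.mem_sdiff.1 he').1).2 (Finset.mem_sdiff.1 he).1
      show monomial (∑ e ∈ C \ F, Finsupp.single e 1) (1 : ℝ) * monomial (∑ e ∈ (groundLines M \ C) \ T', Finsupp.single e 1) (1 : ℝ)
          = monomial (∑ e ∈ groundLines M \ (F ∪ T'), Finsupp.single e 1) (1 : ℝ)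
      rw [monomial_mul, one_mul, hsplit, sumSingle_union hdisj]
  -- (B) `in_β V_M = in_β q`
  have hB : initForm (basisPolynomial M) β = initForm q β := by
    refine initForm_eq_of_support_subset β (basisPolynomial_ne_zero M) ?_ ?_ ?_
    · -- `supp q ⊆ supp V_M`
      intro d hd
      rw [mem_support_iff, hq, coeff_sum_monomial_sumSingle fam _ hinj d] at hd
      rw [support_basisPolynomial]
      by_cases h : d ∈ fam.image (fun B => (∑ e ∈ groundLines M \ B, Finsupp.single e (1 : ℕ) : Fin N →₀ ℕ))
      · obtain ⟨B, hBf, rfl⟩ := Finset.mem_image.1 h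
        exact Finset.mem_image.2 ⟨B, hfam_sub hBf, rfl⟩
      · exact absurd (if_neg h) hd
    · -- same coefficients (`1`) on `supp q`
      intro d hd
      rw [mem_support_iff, hq, coeff_sum_monomial_sumSingle fam _ hinj d] at hd
      rw [hq, coeff_sum_monomial_sumSingle fam _ hinj d, coeff_basisPolynomial]
      by_cases h : d ∈ fam.image (fun B => (∑ e ∈ groundLines M \ B, Finsupp.single e (1 : ℕ) : Fin N →₀ ℕ))
      · obtain ⟨B, hBf, rfl⟩ := Finset.mem_image.1 h
        rw [if_pos h, if_pos (Finset.mem_image.2 ⟨B, hfam_sub hBf, rfl⟩)]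
      · exact absurd (if_neg h) hd
    · -- every dominant co-base monomial lies in the family
      intro d hd hmin
      rw [support_basisPolynomial] at hd
      obtain ⟨B, hB, rfl⟩ := Finset.mem_image.1 hd
      have hbase : M.IsBase (B : Set (Fin N)) := mem_baseFinsets.1 hB
      have hBg : B ⊆ groundLines M := subset_groundLines_of_mem_baseFinsets hB
      -- `B` has maximal weight among the bases
      have hmax : ∀ B' : Finset (Fin N), M.IsBase (B' : Set (Fin N)) → ∑ x ∈ B', β x ≤ ∑ x ∈ B, β x := by
        intro B' hB'
        have hB'g : B' ⊆ groundLines M := subset_groundLines_of_mem_baseFinsets (mem_baseFinsets.2 hB')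
        have hle : rayOrder (basisPolynomial M) β ≤ linPair (castExp (∑ e ∈ groundLines M \ B', Finsupp.single e (1 : ℕ))) β := by
          have hP : basisPolynomial M ≠ 0 := basisPolynomial_ne_zero M
          rw [rayOrder_eq_inf' hP]
          refine Finset.inf'_le _ ?_
          rw [support_basisPolynomial]
          exact Finset.mem_image.2 ⟨B', mem_baseFinsets.2 hB', rfl⟩
        rw [← hmin, linPair_castExp_sumSingle, linPair_castExp_sumSingle] at hle
        have h1 := Finset.sum_sdiff (f := β) hBg
        have h2 := Finset.sum_sdiff (f := β) hB'g
        linarith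
      -- hence `B` meets the level set `{β ≥ c}` in a basis of it (§1) …
      have hL := isBasis_filter_of_forall_sum_le hbase β hmax c
      -- … and `C` in a basis of `C`
      have hfilt_sub : ((C.filter fun e => c ≤ β e : Finset (Fin N)) : Set (Fin N)) ⊆ {x | x ∈ M.E ∧ c ≤ β x} := by
        intro x hx
        rw [Finset.coe_filter] at hx
        exact ⟨hCE hx.1, hx.2⟩
      have hBfilt_sub : ((B.filter fun e => c ≤ β e : Finset (Fin N)) : Set (Fin N)) ⊆ ((B ∩ C : Finset (Fin N)) : Set (Fin N)) := by
        intro x hx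
        rw [Finset.coe_filter] at hx
        rw [Finset.coe_inter]
        refine ⟨hx.1, ?_⟩
        by_contra hxC
        have hxE : x ∈ M.E := hbase.subset_ground hx.1
        exact absurd hx.2 (not_le.2 (hoff x hxE hxC))
      have hCcl : (C : Set (Fin N)) ⊆ M.closure ((B ∩ C : Finset (Fin N)) : Set (Fin N)) := by
        refine hspan.trans ?_
        refine (M.closure_subset_closure_of_subset_closure (hfilt_sub.trans hL.subset_closure)).trans ?_
        exact M.closure_subset_closure hBfilt_sub
      have hind : M.Indep ((B ∩ C : Finset (Fin N)) : Set (Fin N)) :=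
        hbase.indep.subset (by rw [Finset.coe_inter]; exact Set.inter_subset_left)
      have hbasis : M.IsBasis ((B ∩ C : Finset (Fin N)) : Set (Fin N)) (C : Set (Fin N)) :=
        hind.isBasis_of_subset_of_subset_closure (by rw [Finset.coe_inter]; exact Set.inter_subset_right) hCcl
      have hBfam : B ∈ fam := by
        rw [hfam, Finset.mem_filter]
        exact ⟨hB, hbasis⟩
      rw [mem_support_iff, hq, coeff_sum_monomial_sumSingle fam _ hinj, if_pos (Finset.mem_image.2 ⟨B, hBfam, rfl⟩)]
      exact one_ne_zero
  rw [hB, hA]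

/-- **H(C, c) ⇒ «V_{M|C} V_{M/C} ∼ V_M»** in footnote 16's sense along every `z_l = c_l δ^{β_l}`, `c_l > 0`. [cite: Volkov2016, §5.3 (24) first relation (p.1177, PDF p.15 L67–L71) with footnote 16 (PDF p.12 L97–L99) and App. C (p.1189, PDF p.26 L42–L56)] -/
theorem tendsto_restrict_mul_contract_div_of_level (M : Matroid (Fin N)) (β : Fin N → ℝ) {C : Finset (Fin N)}
    (hCE : (C : Set (Fin N)) ⊆ M.E) {c : ℝ} (hoff : ∀ e ∈ M.E, e ∉ C → β e < c)
    (hspan : (C : Set (Fin N)) ⊆ M.closure ((C.filter fun e => c ≤ β e : Finset (Fin N)) : Set (Fin N)))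
    (x : Fin N → ℝ) (hx : ∀ i, 0 < x i) :
    Tendsto (fun δ : ℝ => eval (rayPath x β δ) (basisPolynomial (M ↾ (C : Set (Fin N))) * basisPolynomial (M ／ (C : Set (Fin N)))) /
        eval (rayPath x β δ) (basisPolynomial M)) (𝓝[>] 0) (𝓝 1) :=
  tendsto_div_one_of_initForm_eq β x (initForm_basisPolynomial_eq_of_level M β hCE hoff hspan).symm
    (eval_initForm_basisPolynomial_pos M β hx).ne'

end MinorRefinement

/-! ## §10 App. C: the blocks `V_{G_b/G_a}` of a nested chain and the refinement of a block at an intermediate subgraph -/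

section Blocks

variable {N : ℕ}

/-- **`V_{G_b/G_a}`** — the 1-tree polynomial of the quotient of the subgraph spanned by the line set `B` by the subgraph spanned by
`A ⊆ B` (App. C's blocks for the chain `G₀ ⊂ G₁ ⊂ … ⊂ G_{n+1} = G`, `G₀` = the external vertex = no lines), typed as the basis
polynomial of the minor `(M|B)/A`. [cite: Volkov2016, App. C p.1188–1189 (PDF p.25 L96–L107; p.26 L42–L56); Oxley2011, §3.1 Prop. 3.1.7] -/
def blockPolynomial (M : Matroid (Fin N)) (A B : Finset (Fin N)) : MvPolynomial (Fin N) ℝ :=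
  basisPolynomial ((M ↾ (B : Set (Fin N))) ／ (A : Set (Fin N)))

/-- `V_{G_b/G_0} = V_{M|G_b}` (the innermost block is a subgraph polynomial). [cite: Volkov2016, App. C p.1188 (PDF p.25 L96–L107)] -/
theorem blockPolynomial_empty (M : Matroid (Fin N)) (B : Finset (Fin N)) :
    blockPolynomial M ∅ B = basisPolynomial (M ↾ (B : Set (Fin N))) := by
  rw [blockPolynomial, Finset.coe_empty, Matroid.contract_empty]

/-- `V_{G/G_0} = V` for the whole line set of a connected edge list. [cite: Volkov2016, App. C p.1188 (PDF p.25 L96–L107)] -/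
theorem blockPolynomial_empty_univ {V : ℕ} (E : Fin N → Fin (V + 1) × Fin (V + 1)) (hconn : IsConnectedEdgeList E) :
    blockPolynomial (cycleMatroid E) ∅ univ = kirchhoffPolynomial ℝ E := by
  rw [blockPolynomial_empty, Finset.coe_univ, ← cycleMatroid_ground E, Matroid.restrict_ground_eq_self,
    basisPolynomial_cycleMatroid E hconn]

/-- `V_{G_b/G_a} ≠ 0`. [cite: Oxley2011, §1.2 (B1)] -/
theorem blockPolynomial_ne_zero (M : Matroid (Fin N)) (A B : Finset (Fin N)) : blockPolynomial M A B ≠ 0 :=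
  basisPolynomial_ne_zero _

open scoped Classical in
/-- **ONE REFINEMENT STEP OF APP. C's CHAINS**: for line sets `A ⊆ S ⊆ B`, if every line of `B ∖ S` has weight `< c` and the lines
of `S ∖ A` of weight `≥ c` span `S ∖ A` in the block minor `(M|B)/A` (H at the index of `S` — in Volkov's setting: at an
inverse-transition index inside a transition-free block the INNER electron path carries the larger weights and spans), then
`in_β V_{G_b/G_a} = in_β (V_{G_s/G_a} · V_{G_b/G_s})`. Minor algebra: `((M|B)/A)|(S∖A) = (M|S)/A`, `((M|B)/A)/(S∖A) = (M|B)/S`.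
[cite: Volkov2016, App. C p.1189 (PDF p.26 L42–L56: «V_{G_{i₁}/G_{i₀}} … V_{G_{i_r}/G_{i_{r−1}}} ∼ V_{G_{j₁}/G_{j₀}} … V_{G_{j_l}/G_{j_{l−1}}}») with p.1188–1189 (PDF p.25 L96 – p.26 L4); Oxley2011, §3.1 Prop. 3.1.26 (minors of minors)] -/
theorem initForm_blockPolynomial_refine (M : Matroid (Fin N)) (β : Fin N → ℝ) {A S B : Finset (Fin N)} (hAS : A ⊆ S)
    (hSB : S ⊆ B) {c : ℝ} (hoff : ∀ e ∈ B, e ∉ S → β e < c)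
    (hspan : ((S \ A : Finset (Fin N)) : Set (Fin N)) ⊆
      ((M ↾ (B : Set (Fin N))) ／ (A : Set (Fin N))).closure (((S \ A).filter fun e => c ≤ β e : Finset (Fin N)) : Set (Fin N))) :
    initForm (blockPolynomial M A B) β = initForm (blockPolynomial M A S * blockPolynomial M S B) β := by
  set M' : Matroid (Fin N) := (M ↾ (B : Set (Fin N))) ／ (A : Set (Fin N)) with hM'
  have hground : M'.E = (B : Set (Fin N)) \ (A : Set (Fin N)) := by
    rw [hM', Matroid.contract_ground, Matroid.restrict_ground_eq]
  have hCE : ((S \ A : Finset (Fin N)) : Set (Fin N)) ⊆ M'.E := by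
    rw [hground, Finset.coe_sdiff]
    exact Set.sdiff_subset_sdiff_left (Finset.coe_subset.2 hSB)
  have hoff' : ∀ e ∈ M'.E, e ∉ S \ A → β e < c := by
    intro e he heS
    rw [hground] at he
    have heB : e ∈ B := Finset.mem_coe.1 he.1
    have heA : e ∉ A := fun h => he.2 (Finset.mem_coe.2 h)
    exact hoff e heB fun h => heS (Finset.mem_sdiff.2 ⟨h, heA⟩)
  have h := initForm_basisPolynomial_eq_of_level M' β hCE hoff' hspan
  have h1 : M' ↾ ((S \ A : Finset (Fin N)) : Set (Fin N)) = (M ↾ (S : Set (Fin N))) ／ (A : Set (Fin N)) := by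
    rw [hM', Finset.coe_sdiff, Matroid.contract_restrict_eq_restrict_contract _ Set.disjoint_sdiff_right,
      Set.sdiff_union_of_subset (Finset.coe_subset.2 hAS), Matroid.restrict_restrict_eq _ (Finset.coe_subset.2 hSB)]
  have h2 : M' ／ ((S \ A : Finset (Fin N)) : Set (Fin N)) = (M ↾ (B : Set (Fin N))) ／ (S : Set (Fin N)) := by
    rw [hM', Finset.coe_sdiff, Matroid.contract_contract, Set.union_sdiff_cancel (Finset.coe_subset.2 hAS)]
  rw [blockPolynomial, blockPolynomial, blockPolynomial, ← hM', h, h1, h2]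

/-- The same step with a cofactor `R` (any non-zero polynomial, e.g. the product of the other blocks of the chain):
`in_β (R · V_{G_b/G_a}) = in_β (R · V_{G_s/G_a} · V_{G_b/G_s})`. [cite: Volkov2016, App. C p.1189 (PDF p.26 L42–L56)] -/
theorem initForm_mul_blockPolynomial_refine (M : Matroid (Fin N)) (β : Fin N → ℝ) {R : MvPolynomial (Fin N) ℝ} (hR : R ≠ 0)
    {A S B : Finset (Fin N)} (hAS : A ⊆ S) (hSB : S ⊆ B) {c : ℝ} (hoff : ∀ e ∈ B, e ∉ S → β e < c)
    (hspan : ((S \ A : Finset (Fin N)) : Set (Fin N)) ⊆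
      ((M ↾ (B : Set (Fin N))) ／ (A : Set (Fin N))).closure (((S \ A).filter fun e => c ≤ β e : Finset (Fin N)) : Set (Fin N))) :
    initForm (R * blockPolynomial M A B) β = initForm (R * (blockPolynomial M A S * blockPolynomial M S B)) β :=
  initForm_mul_congr_right hR (blockPolynomial_ne_zero M A B)
    (mul_ne_zero (blockPolynomial_ne_zero M A S) (blockPolynomial_ne_zero M S B)) β
    (initForm_blockPolynomial_refine M β hAS hSB hoff hspan)

open scoped Classical in
/-- **«V_{G_s/G_a} V_{G_b/G_s} ∼ V_{G_b/G_a}»** — the refinement step read in footnote 16's sense: along every `z_l = c_l δ^{β_l}` with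
`c_l > 0` the ratio tends to `1` as `δ → 0⁺`. [cite: Volkov2016, App. C p.1189 (PDF p.26 L42–L56) with footnote 16 (PDF p.12 L97–L99)] -/
theorem tendsto_blockPolynomial_refine_div (M : Matroid (Fin N)) (β : Fin N → ℝ) {A S B : Finset (Fin N)} (hAS : A ⊆ S)
    (hSB : S ⊆ B) {c : ℝ} (hoff : ∀ e ∈ B, e ∉ S → β e < c)
    (hspan : ((S \ A : Finset (Fin N)) : Set (Fin N)) ⊆
      ((M ↾ (B : Set (Fin N))) ／ (A : Set (Fin N))).closure (((S \ A).filter fun e => c ≤ β e : Finset (Fin N)) : Set (Fin N)))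
    (x : Fin N → ℝ) (hx : ∀ i, 0 < x i) :
    Tendsto (fun δ : ℝ => eval (rayPath x β δ) (blockPolynomial M A S * blockPolynomial M S B) /
        eval (rayPath x β δ) (blockPolynomial M A B)) (𝓝[>] 0) (𝓝 1) :=
  tendsto_div_one_of_initForm_eq β x (initForm_blockPolynomial_refine M β hAS hSB hoff hspan).symm
    (eval_initForm_basisPolynomial_pos _ β hx).ne'

end Blocks

/-! ## §11 (appended, additions only) App. C's CHAIN PRODUCTS `V_{G_{i₁}/G_{i₀}} ⋯ V_{G_{i_r}/G_{i_{r−1}}}`: inserting an H-index does not change the initial form; the order of a chain product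

The product over the consecutive blocks of an index chain `i₀ < i₁ < … < i_r` is typed as `chainProdFrom M (G i₀) [G i₁, …, G i_r]`; App. C's
«V_{G_{i₁}/G_{i₀}} … V_{G_{i_r}/G_{i_{r−1}}} ∼ V_{G_{j₁}/G_{j₀}} … V_{G_{j_l}/G_{j_{l−1}}}» for two chains differing by indices at which H
holds is the iteration of `initForm_chainProdFrom_insert` (one index at a time); «≍ δ^{…}» is `rayOrder` of the product =
the sum of the blocks' orders (`rayOrder_chainProdFrom_cons`), each block's order being the co-weight of any maximum-weight base of the
block minor (`rayOrder_basisPolynomial_eq_of_forall_sum_le` — in Volkov's setting the electron path of the block, «доминирующим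
1-деревом», whose co-base is the block's photon set; that identification is per graph and NOT typed). -/

section Chains

variable {N : ℕ}

/-- **The chain product from `A`**: `chainProdFrom M A [B₁, …, B_r] = V_{B₁/A} · V_{B₂/B₁} ⋯ V_{B_r/B_{r−1}}` (App. C's
`V_{G_{i₁}/G_{i₀}} ⋯ V_{G_{i_r}/G_{i_{r−1}}}` with `A = G_{i₀}`). [cite: Volkov2016, App. C p.1188–1189 (PDF p.25 L96–L107; p.26 L42–L56)] -/
def chainProdFrom (M : Matroid (Fin N)) : Finset (Fin N) → List (Finset (Fin N)) → MvPolynomial (Fin N) ℝ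
  | _, [] => 1
  | A, B :: l => blockPolynomial M A B * chainProdFrom M B l

/-- Unfolding on an empty chain. [cite: Volkov2016, App. C p.1189 (PDF p.26 L42–L56)] -/
@[simp] theorem chainProdFrom_nil (M : Matroid (Fin N)) (A : Finset (Fin N)) : chainProdFrom M A [] = 1 := rfl

/-- Unfolding one block. [cite: Volkov2016, App. C p.1189 (PDF p.26 L42–L56)] -/
@[simp] theorem chainProdFrom_cons (M : Matroid (Fin N)) (A B : Finset (Fin N)) (l : List (Finset (Fin N))) :
    chainProdFrom M A (B :: l) = blockPolynomial M A B * chainProdFrom M B l := rfl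

/-- A chain product is non-zero. [cite: Oxley2011, §1.2 (B1)] -/
theorem chainProdFrom_ne_zero (M : Matroid (Fin N)) (A : Finset (Fin N)) (l : List (Finset (Fin N))) : chainProdFrom M A l ≠ 0 := by
  induction l generalizing A with
  | nil => exact one_ne_zero
  | cons B l ih => exact mul_ne_zero (blockPolynomial_ne_zero M A B) (ih B)

/-- Splitting a chain product at a block: `⋯ V_{C/B} ⋯ = (blocks up to B) · V_{C/B} · (blocks from C)`. [cite: Volkov2016, App. C p.1189 (PDF p.26 L42–L56)] -/
theorem chainProdFrom_append_cons_cons (M : Matroid (Fin N)) (A B C : Finset (Fin N)) (l₁ l₂ : List (Finset (Fin N))) :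
    chainProdFrom M A (l₁ ++ B :: C :: l₂) = chainProdFrom M A (l₁ ++ [B]) * blockPolynomial M B C * chainProdFrom M C l₂ := by
  induction l₁ generalizing A with
  | nil => simp [mul_assoc]
  | cons D l₁ ih => simp [ih, mul_assoc]

/-- The initial form of a chain product is positive on the positive orthant. [cite: Volkov2016, §5.2 footnote 16 (PDF p.12 L97–L99) with App. A (p.1185)] -/
theorem eval_initForm_chainProdFrom_pos (M : Matroid (Fin N)) (β : Fin N → ℝ) {x : Fin N → ℝ} (hx : ∀ i, 0 < x i)
    (A : Finset (Fin N)) (l : List (Finset (Fin N))) : 0 < eval x (initForm (chainProdFrom M A l) β) := by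
  induction l generalizing A with
  | nil =>
    rw [chainProdFrom_nil]
    exact eval_initForm_pos_of_coeff_nonneg one_ne_zero (fun d _ => by rw [coeff_one]; split_ifs <;> norm_num) β hx
  | cons D l ih =>
    rw [chainProdFrom_cons, initForm_mul (blockPolynomial_ne_zero M A D) (chainProdFrom_ne_zero M D l), map_mul]
    exact mul_pos (eval_initForm_basisPolynomial_pos _ β hx) (ih D)

open scoped Classical in
/-- **INSERTING AN H-INDEX INTO A CHAIN DOES NOT CHANGE THE INITIAL FORM** (App. C: two index chains that both contain the transition
indices and differ by inverse-transition indices give asymptotically equal products — here: by ANY line set `S` between consecutive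
members `B ⊆ C` of the chain at which H(S) holds in the block minor `(M|C)/B`; iterate for several indices).
[cite: Volkov2016, App. C p.1189 (PDF p.26 L42–L56: «V_{G_{i₁}/G_{i₀}} … V_{G_{i_r}/G_{i_{r−1}}} ∼ V_{G_{j₁}/G_{j₀}} … V_{G_{j_l}/G_{j_{l−1}}}»)] -/
theorem initForm_chainProdFrom_insert (M : Matroid (Fin N)) (β : Fin N → ℝ) (A B S C : Finset (Fin N)) (l₁ l₂ : List (Finset (Fin N)))
    (hBS : B ⊆ S) (hSC : S ⊆ C) {c : ℝ} (hoff : ∀ e ∈ C, e ∉ S → β e < c)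
    (hspan : ((S \ B : Finset (Fin N)) : Set (Fin N)) ⊆
      ((M ↾ (C : Set (Fin N))) ／ (B : Set (Fin N))).closure (((S \ B).filter fun e => c ≤ β e : Finset (Fin N)) : Set (Fin N))) :
    initForm (chainProdFrom M A (l₁ ++ B :: C :: l₂)) β = initForm (chainProdFrom M A (l₁ ++ B :: S :: C :: l₂)) β := by
  have hsplit₂ : chainProdFrom M A (l₁ ++ B :: S :: C :: l₂) =
      chainProdFrom M A (l₁ ++ [B]) * (blockPolynomial M B S * blockPolynomial M S C) * chainProdFrom M C l₂ := by
    have h := chainProdFrom_append_cons_cons M A S C (l₁ ++ [B]) l₂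
    rw [List.append_assoc, List.singleton_append] at h
    rw [h, show l₁ ++ [B] ++ [S] = l₁ ++ B :: [S] by simp, chainProdFrom_append_cons_cons M A B S l₁ []]
    simp [mul_assoc]
  rw [chainProdFrom_append_cons_cons, hsplit₂]
  have hX : chainProdFrom M A (l₁ ++ [B]) ≠ 0 := chainProdFrom_ne_zero M A _
  have hY : chainProdFrom M C l₂ ≠ 0 := chainProdFrom_ne_zero M C _
  have hV : blockPolynomial M B C ≠ 0 := blockPolynomial_ne_zero M B C
  have hVV : blockPolynomial M B S * blockPolynomial M S C ≠ 0 :=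
    mul_ne_zero (blockPolynomial_ne_zero M B S) (blockPolynomial_ne_zero M S C)
  rw [initForm_mul (mul_ne_zero hX hV) hY, initForm_mul (mul_ne_zero hX hVV) hY, initForm_mul hX hV, initForm_mul hX hVV,
    initForm_blockPolynomial_refine M β hBS hSC hoff hspan]

open scoped Classical in
/-- The same insertion, read as footnote 16's «∼»: the ratio of the two chain products tends to `1` along every `z_l = c_l δ^{β_l}`,
`c_l > 0`. [cite: Volkov2016, App. C p.1189 (PDF p.26 L42–L56) with footnote 16 (PDF p.12 L97–L99)] -/
theorem tendsto_chainProdFrom_insert_div (M : Matroid (Fin N)) (β : Fin N → ℝ) (A B S C : Finset (Fin N))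
    (l₁ l₂ : List (Finset (Fin N))) (hBS : B ⊆ S) (hSC : S ⊆ C) {c : ℝ} (hoff : ∀ e ∈ C, e ∉ S → β e < c)
    (hspan : ((S \ B : Finset (Fin N)) : Set (Fin N)) ⊆
      ((M ↾ (C : Set (Fin N))) ／ (B : Set (Fin N))).closure (((S \ B).filter fun e => c ≤ β e : Finset (Fin N)) : Set (Fin N)))
    (x : Fin N → ℝ) (hx : ∀ i, 0 < x i) :
    Tendsto (fun δ : ℝ => eval (rayPath x β δ) (chainProdFrom M A (l₁ ++ B :: S :: C :: l₂)) /
        eval (rayPath x β δ) (chainProdFrom M A (l₁ ++ B :: C :: l₂))) (𝓝[>] 0) (𝓝 1) :=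
  tendsto_div_one_of_initForm_eq β x (initForm_chainProdFrom_insert M β A B S C l₁ l₂ hBS hSC hoff hspan).symm
    (eval_initForm_chainProdFrom_pos M β hx A _).ne'

/-! ### The order of a block and of a chain product -/

/-- **The order of `V_M` is the co-weight of any maximum-weight base**: if the base `B` has maximal weight `Σ_{e∈B} β_e`, then
`rayOrder V_M β = Σ_{e ∈ E(M)∖B} β_e` (App. C's «≍ δ^{(1/2)Σ_j w_j(N_{G_{j+1}} − N_{G_j})}» once the dominant base of each block is
its electron path, whose co-base is the block's photon set — that identification is per graph, not typed).
[cite: Volkov2016, App. C p.1188–1189 (PDF p.25 L96 – p.26 L4: «электронный путь … доминирующим 1-деревом по степени δ») and §5.2 p.1175 (PDF p.12 L92–L94)] -/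
theorem rayOrder_basisPolynomial_eq_of_forall_sum_le (M : Matroid (Fin N)) (β : Fin N → ℝ) {B : Finset (Fin N)}
    (hB : M.IsBase (B : Set (Fin N))) (hmax : ∀ B' : Finset (Fin N), M.IsBase (B' : Set (Fin N)) → ∑ x ∈ B', β x ≤ ∑ x ∈ B, β x) :
    rayOrder (basisPolynomial M) β = ∑ e ∈ groundLines M \ B, β e := by
  have hP : basisPolynomial M ≠ 0 := basisPolynomial_ne_zero M
  have hBg : B ⊆ groundLines M := subset_groundLines_of_mem_baseFinsets (mem_baseFinsets.2 hB)
  rw [rayOrder_eq_inf' hP]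
  refine le_antisymm ?_ ?_
  · refine Finset.inf'_le_of_le _ (by rw [support_basisPolynomial]; exact Finset.mem_image.2 ⟨B, mem_baseFinsets.2 hB, rfl⟩) ?_
    rw [linPair_castExp_sumSingle]
  · refine Finset.le_inf' _ _ fun d hd => ?_
    rw [support_basisPolynomial] at hd
    obtain ⟨B', hB', rfl⟩ := Finset.mem_image.1 hd
    have hB'g : B' ⊆ groundLines M := subset_groundLines_of_mem_baseFinsets hB'
    rw [linPair_castExp_sumSingle]
    have h1 := Finset.sum_sdiff (f := β) hBg
    have h2 := Finset.sum_sdiff (f := β) hB'g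
    have h3 := hmax B' (mem_baseFinsets.1 hB')
    linarith

/-- **Orders add along a chain**: `rayOrder (V_{B/A} · chain from B) = rayOrder V_{B/A} + rayOrder (chain from B)`.
[cite: Volkov2016, App. C p.1189 (PDF p.26 L42–L56) with §5.1 (19)–(20)] -/
theorem rayOrder_chainProdFrom_cons (M : Matroid (Fin N)) (β : Fin N → ℝ) (A B : Finset (Fin N)) (l : List (Finset (Fin N))) :
    rayOrder (chainProdFrom M A (B :: l)) β = rayOrder (blockPolynomial M A B) β + rayOrder (chainProdFrom M B l) β := by
  rw [chainProdFrom_cons, rayOrder_mul (blockPolynomial_ne_zero M A B) (chainProdFrom_ne_zero M B l)]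

end Chains

/-! ## §12 (appended, additions only) The hypothesis H in ambient terms: closure in `M`, and rank in the cycle matroid -/

section Ambient

variable {N : ℕ}

/-- **H read in the ambient matroid.** For `B ⊆ S ⊆ C ⊆ E(M)` and `X ⊆ S ∖ B`: if `X` together with `B` spans `S` in `M`, then `X`
spans `S ∖ B` in the block minor `(M|C)/B` (Mathlib: `cl_{M/B} X = cl_M(X ∪ B) ∖ B`, `cl_{M|C} Y = cl_M Y ∩ C`). With
`X = {l ∈ S ∖ B : β_l ≥ c}` this is the `hspan` of `initForm_blockPolynomial_refine` / `initForm_chainProdFrom_insert`.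
[cite: Oxley2011, §3.1 Prop. 3.1.11 (closure in a contraction) and §1.3 (restriction); Volkov2016, App. C p.1188–1189 (PDF p.25 L96 – p.26 L4)] -/
theorem sdiff_subset_closure_block {M : Matroid (Fin N)} {B S C X : Finset (Fin N)} (hBS : B ⊆ S) (hSC : S ⊆ C)
    (hCE : (C : Set (Fin N)) ⊆ M.E) (hX : X ⊆ S \ B) (hspan : (S : Set (Fin N)) ⊆ M.closure ((X : Set (Fin N)) ∪ (B : Set (Fin N)))) :
    ((S \ B : Finset (Fin N)) : Set (Fin N)) ⊆ ((M ↾ (C : Set (Fin N))) ／ (B : Set (Fin N))).closure (X : Set (Fin N)) := by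
  have hXB : (X : Set (Fin N)) ∪ (B : Set (Fin N)) ⊆ (C : Set (Fin N)) := by
    refine Set.union_subset ?_ (Finset.coe_subset.2 (hBS.trans hSC))
    exact (Finset.coe_subset.2 hX).trans ((Finset.coe_subset.2 Finset.sdiff_subset).trans (Finset.coe_subset.2 hSC))
  intro e he
  rw [Finset.coe_sdiff] at he
  rw [Matroid.contract_closure_eq, Matroid.restrict_closure_eq _ hXB hCE]
  exact ⟨⟨hspan he.1, Finset.coe_subset.2 hSC he.1⟩, he.2⟩

variable {V : ℕ} (E : Fin N → Fin (V + 1) × Fin (V + 1))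

/-- **Rank equality ⇒ spanning, in the cycle matroid**: if `X ⊆ Y` have the same `edgeRank`, then `Y ⊆ cl X` (a maximal forest of
`X` is already a maximal forest of `Y`). [cite: Oxley2011, §1.4 Lemma 1.4.3 / §1.3 (rank and closure)] -/
theorem subset_closure_of_edgeRank_eq {X Y : Finset (Fin N)} (hXY : X ⊆ Y) (h : edgeRank E X = edgeRank E Y) :
    (Y : Set (Fin N)) ⊆ (cycleMatroid E).closure (X : Set (Fin N)) := by
  obtain ⟨I, hI⟩ := exists_isBasis_cycleMatroid E X
  have hIX := (isBasis_cycleMatroid_iff E I X).1 hI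
  have hIY : (cycleMatroid E).IsBasis (I : Set (Fin N)) (Y : Set (Fin N)) := by
    refine hI.indep.isBasis_of_eRk_ge I.finite_toSet ((Finset.coe_subset.2 hIX.1).trans (Finset.coe_subset.2 hXY)) ?_ (by simp)
    rw [eRk_cycleMatroid_eq_edgeRank, eRk_cycleMatroid_eq_edgeRank, ← h, ← hIX.2.2, hIX.2.1]
  exact hIY.subset_closure.trans ((cycleMatroid E).closure_subset_closure (Finset.coe_subset.2 hIX.1))

open scoped Classical in
/-- **App. C's refinement step for the blocks of a GRAPH, rank form**: for line sets `B ⊆ S ⊆ C`, if every line of `C ∖ S` has weight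
`< c` and `rk({l ∈ S ∖ B : β_l ≥ c} ∪ B) = rk S` (the heavy lines of the level together with the inner subgraph span `S` — for the
vectors (45): the inner electron path), then `in_β V_{G_C/G_B} = in_β (V_{G_S/G_B} · V_{G_C/G_S})`.
[cite: Volkov2016, App. C p.1189 (PDF p.26 L42–L56) with p.1188–1189 (PDF p.25 L96 – p.26 L4)] -/
theorem initForm_blockPolynomial_refine_cycleMatroid (β : Fin N → ℝ) {B S C : Finset (Fin N)} (hBS : B ⊆ S) (hSC : S ⊆ C)
    {c : ℝ} (hoff : ∀ e ∈ C, e ∉ S → β e < c)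
    (hrank : edgeRank E (((S \ B).filter fun e => c ≤ β e) ∪ B) = edgeRank E S) :
    initForm (blockPolynomial (cycleMatroid E) B C) β =
      initForm (blockPolynomial (cycleMatroid E) B S * blockPolynomial (cycleMatroid E) S C) β := by
  have hsub : ((S \ B).filter fun e => c ≤ β e) ∪ B ⊆ S :=
    Finset.union_subset ((Finset.filter_subset _ _).trans Finset.sdiff_subset) hBS
  have hcl := subset_closure_of_edgeRank_eq E hsub hrank
  rw [Finset.coe_union] at hcl
  exact initForm_blockPolynomial_refine (cycleMatroid E) β hBS hSC hoff
    (sdiff_subset_closure_block hBS hSC (by simp) (Finset.filter_subset _ _) hcl)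

open scoped Classical in
/-- The chain form for a graph, rank hypothesis: inserting `S` between consecutive members `B ⊆ C` of a chain of line sets.
[cite: Volkov2016, App. C p.1189 (PDF p.26 L42–L56)] -/
theorem initForm_chainProdFrom_insert_cycleMatroid (β : Fin N → ℝ) (A B S C : Finset (Fin N)) (l₁ l₂ : List (Finset (Fin N)))
    (hBS : B ⊆ S) (hSC : S ⊆ C) {c : ℝ} (hoff : ∀ e ∈ C, e ∉ S → β e < c)
    (hrank : edgeRank E (((S \ B).filter fun e => c ≤ β e) ∪ B) = edgeRank E S) :
    initForm (chainProdFrom (cycleMatroid E) A (l₁ ++ B :: C :: l₂)) β =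
      initForm (chainProdFrom (cycleMatroid E) A (l₁ ++ B :: S :: C :: l₂)) β := by
  have hsub : ((S \ B).filter fun e => c ≤ β e) ∪ B ⊆ S :=
    Finset.union_subset ((Finset.filter_subset _ _).trans Finset.sdiff_subset) hBS
  have hcl := subset_closure_of_edgeRank_eq E hsub hrank
  rw [Finset.coe_union] at hcl
  exact initForm_chainProdFrom_insert (cycleMatroid E) β A B S C l₁ l₂ hBS hSC hoff
    (sdiff_subset_closure_block hBS hSC (by simp) (Finset.filter_subset _ _) hcl)

end Ambient

end Literature.MathematicalPhysics.QuantumFieldTheory.Volkov2016
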